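import Summits.BirchSwinnertonDyer.BirchSwinnertonDyer.Theses.SignedLowerHalves
import Summits.BirchSwinnertonDyer.BirchSwinnertonDyer.Theorems.SignedLowerHalvesKobayashiMainConjectureSmallImageOrbitSumMuThree
import Literature.NumberTheory.EllipticCurves.PAdicLFunctionDistributionProofs
import Literature.NumberTheory.EllipticCurves.PAdicLFunctionDistributionHoldsProofs
import Literature.NumberTheory.EllipticCurves.ModularSymbolsLattice
import Literature.NumberTheory.EllipticCurves.ModularSymbolsProofs
import Literature.NumberTheory.EllipticCurves.ModularCurveRealPeriodProofs
import Literature.NumberTheory.EllipticCurves.ModularFormsGamma0Genus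
import Mathlib.NumberTheory.Padics.PadicNorm
import Mathlib.NumberTheory.ModularForms.CongruenceSubgroups
import HarnessLib
import Mathlib.LinearAlgebra.Matrix.SpecialLinearGroup
import Mathlib.Data.ZMod.Basic
import Mathlib.Data.ZMod.Units
import Mathlib.FieldTheory.Finite.Basic

/-!
# Crux `KobayashiMainConjectureSmallImage` (item stmt-BirchSwinnertonDyer-19002) — ideator bsd-idea-13, gen 9:
# THEOREM A at p = 3, COMPOSED (UNREGISTERED workfile; W-79)

This file is the verbatim concatenation of the two published g9 workfiles `EGSymbolStep_g9.lean` (symbol step,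
commit 1b57a96f43da) and `EGLemmaPrime_g9.lean` (LEMMA′ from Vaserstein–Liehl, commit 1a72be178e47) — crux
workfiles are not importable modules — followed by a COMPOSITION section proving

  `EGLine.stub_muOneSign_ns_three_of_vasersteinLiehl :
     (∀ N, ¬ 3 ∣ N → EGLemmaPrime.VasersteinLiehl 3 N) → <stub_muOneSign_ns_three of Lines/birth_acns.lean v6, verbatim>`

i.e. THEOREM A at p = 3 (one-sign μ = 0 for every rational a₃ = 0 newform, 3 ∤ N) kernel-checked modulo the single
published theorem (VL) [Vaserstein 1972; Liehl 1981], used as a hypothesis and never asserted.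
HONEST SCOPE: sorry-free; proves no route item (the v6 stub still needs the cite-only input (VL)); crux 4 OPEN;
BSD is not proved by this seat.
-/

/-!
# Crux `KobayashiMainConjectureSmallImage` (item stmt-BirchSwinnertonDyer-19002) — ideator bsd-idea-13, gen 9:
# the SYMBOL STEP of EG-REDUCTION-g8 THEOREM A, kernel-checked (UNREGISTERED workfile, not a line; W-79)

WHAT. `EG-REDUCTION-g8.md` (this crux's workfiles) reduces the one-sign μ-rider at `p = 3` to a pure
group-theoretic statement LEMMA′(N,p) about `Γ₀(N)` plus a "symbol step" (§4). This file PROVES the symbol step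
for every odd prime `p ∤ N` with `a_p(f) = 0`:

* `not_allNonUnit_of_lemmaPrimeHom` : `LemmaPrimeHom N p` (LEMMA′ in homomorphism form: every hom `Γ₀(N) → A`,
  `A` abelian, killing the ±p-power-cusp set `S_p` kills `Γ′ = {d ≡ ±p^k mod N}`) ⟹ NOT every plus symbol
  `[a/p^k]⁺_f` (`k ≥ 1`, `p ∤ a`) has `p`-adic norm `< 1`.

  Proof (MTT (4.2) `intCast_mul_ratPlusSymbol`, Manin `modularSymbol_gamma0_smul`, the lattice
  `Re Λ_f = ℤ·Ω⁺_f/2` `realPeriods_eq_zmultiples_of_plusPeriod_pos`): with `R = [·]⁺_f ∈ ℚ` and the surjective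
  homomorphism `k_f : Γ₀(N) → ℤ`, `Re{∞,γ∞} = k_f(γ)·Ω⁺/2`, one has `R(b/d) − R(0) = k_f(γ)/2` for `γ = (a b;c d)`.
  If all `R(a/p^k) ∈ pℤ_(p)`: Hecke at `r = 0` gives `2R(0) = −Σ_{0<j<p} R(j/p) ∈ pℤ_(p)`; hence `k_f ≡ 0 mod p` on
  `S_p`, so (LEMMA′) on `Γ′`, so `k_f(γ) mod p` depends only on `d(γ)·p^ℤ mod N`; Hecke at `r = 1/v`
  (`(v,Np)=1`) then reads `0 ≡ (p+1)(R(0) + k_v/2) mod p`, so `p ∣ k_v`, so `p ∣ k_f(γ)` for all `γ` — contradicting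
  `k_f(γ₁) = 1`.
* `not_allNonUnit_of_lemmaPrimeHom_of_cuspCoeff` / `not_allNonUnit_and_of_lemmaPrimeHom` (rev2): the same
  with `a_p = 0` replaced by `a_p ≢ 1 (mod p)` and `R(0) ∈ pℤ_(p)` as a hypothesis — the symbol step of the
  critic's THEOREM A′ (V40 (e): ordinary non-anomalous `μ(L_p(f)) = 0 ⟸ LEMMA′`; the ordinary hinge
  `μ ≥ 1 ⇒ R(0) ∈ pℤ_p ∧ AllNonUnit` is classical and NOT formalised here).
* `exists_sign_hasUnitContent_three_of_lemmaPrimeHom` : at `p = 3`, with the LEAD's landed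
  `SmallImageOrbitSumMuThree.norm_ratPlusSymbol_three_lt_one_of_not_hasUnitContent` (p636964) and the tree THEOREM
  `pollack_exists_plusMinusPAdicLFunction_holds`: `LemmaPrimeHom N 3` ⟹ `∃ ε L, IsSignedPAdicLFunction f 3 ε L ∧
  HasUnitContent L` for the newform `f` of any `E` with good supersingular reduction at 3 (`a₃ = 0`).
* `muOneSign_ns_three_of_lemmaPrimeHom` : hence the v6 rider of line `birth_acns` in its `∃ ε₀ L₀` form follows from
  the single group-theoretic input `∀ N, ¬ 3 ∣ N → LemmaPrimeHom N 3` (paper proof: EG-REDUCTION-g8 §3 = finite index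
  [Venkataramana 1994, Thm. p.194; Vaserstein 1972] + CSP [Mennicke 1967; Serre 1970] + elementary generation + the
  kernel-checked coset lemma `EGCosetLemma.lean`).

* `exists_norm_ratPlusSymbol_three_eq_one_of_lemmaPrimeHom` / `stub_muOneSign_ns_three_of_lemmaPrimeHom` : the v6
  stub `stub_muOneSign_ns_three` of line `birth_acns` EXACTLY AS TYPED (a unit plus symbol `[u/3^{n+1}]⁺_f`), from
  `∀ N, ¬ 3 ∣ N → LemmaPrimeHom N 3`, adding the tree's integrality `norm_ratPlusSymbol_div_pow_le_one`.

HONEST SCOPE. ENTIRELY SORRY-FREE (farm rc 0, 0 sorries): LEMMA′ enters only as the HYPOTHESIS `LemmaPrimeHom N 3`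
(published-input-level group theory, paper proof EG-REDUCTION-g8 §3; NOT proved here and not asserted). Proves no
route item; crux 4 of route SignedLowerHalves stays OPEN; BSD is not proved by this seat. For LEAD slh-p3: keep v6 and
add ONE stub `stub_lemmaPrimeHom_three : ∀ N : ℕ, ¬ 3 ∣ N → LemmaPrimeHom N 3`, closing `stub_muOneSign_ns_three :=
EGLine.stub_muOneSign_ns_three_of_lemmaPrimeHom stub_lemmaPrimeHom_three` (this file is an unregistered workfile;
copy the needed declarations or have it promoted to `Theorems/` by a prover — W-79: this seat registers nothing).

References: [MazurTateTeitelbaum1986Invent] §I.4 (4.2), §I.8; [Manin1972] §1.5–1.7, Cor. 3.6; [Pollack2003] §6;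
[Venkataramana1994PJM] Theorem (p. 194); EG-REDUCTION-g8.md §2–§4 (this crux's workfiles).
-/

set_option linter.dupNamespace false
set_option autoImplicit false

noncomputable section

open scoped Classical MatrixGroups ModularForm

namespace Summit.BirchSwinnertonDyer.BirchSwinnertonDyer.Cruxes.KobayashiMainConjectureSmallImage.EGLine

open CongruenceSubgroup Literature.NumberTheory.EllipticCurves
  Literature.NumberTheory.EllipticCurves.ModularForms
  Literature.NumberTheory.EllipticCurves.Kobayashi2003
  Literature.NumberTheory.EllipticCurves.GreenbergVatsal2000
  Literature.NumberTheory.EllipticCurves.Rank1Residual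

/-! ## §0 The group-theoretic sets and LEMMA′ (verbatim from `EGSketch_g8.lean`) -/

/-- `S_p`: elements of `Γ₀(N)` whose lower-right entry is `± p^k`. -/
def pPowerCuspSet (N p : ℕ) : Set SL(2, ℤ) :=
  {γ | γ ∈ Gamma0 N ∧ ∃ k : ℕ, ((γ : Matrix (Fin 2) (Fin 2) ℤ) 1 1 = (p : ℤ) ^ k ∨
    (γ : Matrix (Fin 2) (Fin 2) ℤ) 1 1 = -((p : ℤ) ^ k))}

/-- `Γ′`: elements of `Γ₀(N)` whose lower-right entry is `≡ ± p^k (mod N)`. -/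
def gammaPrimeSet (N p : ℕ) : Set SL(2, ℤ) :=
  {γ | γ ∈ Gamma0 N ∧ ∃ k : ℕ, (((γ : Matrix (Fin 2) (Fin 2) ℤ) 1 1 : ℤ) : ZMod N) = (p : ZMod N) ^ k ∨
    (((γ : Matrix (Fin 2) (Fin 2) ℤ) 1 1 : ℤ) : ZMod N) = -((p : ZMod N) ^ k)}

/-- LEMMA′ in homomorphism form: a hom to an abelian group killing `S_p` kills `Γ′`. -/
def LemmaPrimeHom (N p : ℕ) : Prop :=
  ∀ (A : Type) [CommGroup A] (ψ : Gamma0 N →* A),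
    (∀ γ : Gamma0 N, (γ : SL(2, ℤ)) ∈ pPowerCuspSet N p → ψ γ = 1) →
    ∀ γ : Gamma0 N, (γ : SL(2, ℤ)) ∈ gammaPrimeSet N p → ψ γ = 1

/-! ## §1 `p`-adic bookkeeping -/

section Padic

variable {p : ℕ} [hp : Fact p.Prime]

theorem padicNorm_add_lt_one {q r : ℚ} (hq : padicNorm p q < 1) (hr : padicNorm p r < 1) :
    padicNorm p (q + r) < 1 :=
  lt_of_le_of_lt (padicNorm.nonarchimedean (p := p)) (max_lt hq hr)

theorem padicNorm_sub_lt_one {q r : ℚ} (hq : padicNorm p q < 1) (hr : padicNorm p r < 1) :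
    padicNorm p (q - r) < 1 :=
  lt_of_le_of_lt (padicNorm.sub (p := p)) (max_lt hq hr)

theorem padicNorm_sum_lt_one {α : Type*} (s : Finset α) (g : α → ℚ)
    (h : ∀ i ∈ s, padicNorm p (g i) < 1) : padicNorm p (∑ i ∈ s, g i) < 1 := by
  induction s using Finset.induction_on with
  | empty => simp
  | insert a s ha ih =>
    rw [Finset.sum_insert ha]
    exact padicNorm_add_lt_one (h a (Finset.mem_insert_self a s))
      (ih fun i hi => h i (Finset.mem_insert_of_mem hi))

/-- `|2|_p = 1` for an odd prime `p`. -/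
theorem padicNorm_two (hp2 : p ≠ 2) : padicNorm p (2 : ℚ) = 1 := by
  have h := padicNorm.padicNorm_of_prime_of_ne (p := p) (q := 2) hp2
  exact_mod_cast h

/-- An integer `k` with `|k/2|_p < 1` (`p` odd) is divisible by `p`. -/
theorem dvd_of_padicNorm_div_two_lt_one (hp2 : p ≠ 2) {k : ℤ}
    (h : padicNorm p ((k : ℚ) / 2) < 1) : (p : ℤ) ∣ k := by
  rw [padicNorm.div, padicNorm_two hp2, div_one] at h
  exact (padicNorm.int_lt_one_iff k).mp h

/-- `|p·m/2|_p < 1` for an integer `m` (`p` odd). -/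
theorem padicNorm_p_mul_int_div_two_lt_one (hp2 : p ≠ 2) (m : ℤ) :
    padicNorm p ((p : ℚ) * m / 2) < 1 := by
  rw [padicNorm.div, padicNorm_two hp2, div_one, padicNorm.mul]
  calc padicNorm p (p : ℚ) * padicNorm p (m : ℚ)
      ≤ padicNorm p (p : ℚ) * 1 := by
        gcongr
        · exact padicNorm.nonneg _
        · exact padicNorm.of_int m
    _ < 1 := by rw [mul_one]; exact padicNorm.padicNorm_p_lt_one_of_prime

end Padic

/-! ## §2 Elements of `Γ₀(N)` with a prescribed right column -/

/-- For `(t, s·N) = 1` there is `γ = (u s; −wN t) ∈ Γ₀(N)` with right column `(s, t)`. -/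
theorem exists_gamma0_entries (N : ℕ) (s t : ℤ) (h : IsCoprime t (s * N)) :
    ∃ γ : Gamma0 N, ((γ : SL(2, ℤ)) 0 1 : ℤ) = s ∧ ((γ : SL(2, ℤ)) 1 1 : ℤ) = t := by
  obtain ⟨u, w, huw⟩ := h
  let M : SL(2, ℤ) := ⟨!![u, s; -(w * N), t], by
    rw [Matrix.det_fin_two_of]; linear_combination huw⟩
  have hM : M ∈ Gamma0 N := by
    rw [Gamma0_mem]
    show (((-(w * (N : ℤ))) : ℤ) : ZMod N) = 0
    push_cast
    simp
  exact ⟨⟨M, hM⟩, rfl, rfl⟩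

/-! ## §3 The integer period homomorphism `k_f : Γ₀(N) → ℤ`, `Re{∞, γ∞}_f = k_f(γ)·Ω⁺_f/2` -/

section Period

variable {N : ℕ} [NeZero N] (f : CuspForm (Gamma0 N) 2)

/-- `k_f(γ)`: the integer with `Re {∞, γ∞}_f = k · Ω⁺_f/2` (an `ε`-junk value if there is none). -/
def kOf (γ : Gamma0 N) : ℤ :=
  Classical.epsilon fun k : ℤ => (cuspSymbol f γ).re = (k : ℝ) * (plusPeriod f / 2)

variable {f}

theorem exists_int_re_cuspSymbol (hΩ : 0 < plusPeriod f) (γ : Gamma0 N) :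
    ∃ k : ℤ, (cuspSymbol f γ).re = (k : ℝ) * (plusPeriod f / 2) := by
  have hmem : (cuspSymbol f γ).re ∈ realPeriods f :=
    AddSubgroup.mem_map_of_mem _ (cuspSymbol_mem_periodLattice f γ)
  rw [realPeriods_eq_zmultiples_of_plusPeriod_pos f hΩ, AddSubgroup.mem_zmultiples_iff] at hmem
  obtain ⟨k, hk⟩ := hmem
  exact ⟨k, by rw [← hk, zsmul_eq_mul]⟩

theorem kOf_spec (hΩ : 0 < plusPeriod f) (γ : Gamma0 N) :
    (cuspSymbol f γ).re = (kOf f γ : ℝ) * (plusPeriod f / 2) :=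
  Classical.epsilon_spec (exists_int_re_cuspSymbol hΩ γ)

theorem kOf_eq_of_re_eq (hΩ : 0 < plusPeriod f) {γ : Gamma0 N} {k : ℤ}
    (hk : (cuspSymbol f γ).re = (k : ℝ) * (plusPeriod f / 2)) : kOf f γ = k := by
  have h := kOf_spec hΩ γ
  rw [hk] at h
  have hΩ2 : (plusPeriod f / 2) ≠ 0 := by positivity
  exact_mod_cast (mul_right_cancel₀ hΩ2 h).symm

theorem kOf_mul (hΩ : 0 < plusPeriod f) (γ δ : Gamma0 N) :
    kOf f (γ * δ) = kOf f γ + kOf f δ := by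
  apply kOf_eq_of_re_eq hΩ
  rw [cuspSymbol_mul_holds f γ δ, Complex.add_re, kOf_spec hΩ γ, kOf_spec hΩ δ]
  push_cast; ring

theorem kOf_one (hΩ : 0 < plusPeriod f) : kOf f 1 = 0 := by
  apply kOf_eq_of_re_eq hΩ
  simp

theorem kOf_inv (hΩ : 0 < plusPeriod f) (γ : Gamma0 N) : kOf f γ⁻¹ = -kOf f γ := by
  have h := kOf_mul hΩ γ⁻¹ γ
  rw [inv_mul_cancel, kOf_one hΩ] at h
  omega

/-- `k_f` is onto `ℤ`: some `γ₁` has `k_f(γ₁) = 1` (`Re Λ_f = ℤ·Ω⁺/2`). -/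
theorem exists_kOf_eq_one (hΩ : 0 < plusPeriod f) : ∃ γ : Gamma0 N, kOf f γ = 1 := by
  have hmem : plusPeriod f / 2 ∈ realPeriods f := by
    rw [realPeriods_eq_zmultiples_of_plusPeriod_pos f hΩ]
    exact AddSubgroup.mem_zmultiples _
  obtain ⟨z, hz, hzre⟩ := AddSubgroup.mem_map.mp hmem
  have hz' : z ∈ (periodLattice f : Set ℂ) := hz
  rw [coe_periodLattice_eq_range f] at hz'
  obtain ⟨γ, rfl⟩ := hz'
  refine ⟨γ, kOf_eq_of_re_eq hΩ ?_⟩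
  have h : (cuspSymbol f γ).re = plusPeriod f / 2 := hzre
  rw [h]; push_cast; ring

/-- `γ ↦ k_f(γ) mod p`, as a hom to the abelian group `Multiplicative (ZMod p)`. -/
def kHomMod (hΩ : 0 < plusPeriod f) (p : ℕ) : Gamma0 N →* Multiplicative (ZMod p) where
  toFun γ := Multiplicative.ofAdd ((kOf f γ : ℤ) : ZMod p)
  map_one' := by simp [kOf_one hΩ]
  map_mul' γ δ := by simp [kOf_mul hΩ, ofAdd_add]

theorem kHomMod_eq_one_iff (hΩ : 0 < plusPeriod f) (p : ℕ) (γ : Gamma0 N) :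
    kHomMod hΩ p γ = 1 ↔ (p : ℤ) ∣ kOf f γ := by
  change Multiplicative.ofAdd ((kOf f γ : ℤ) : ZMod p) = 1 ↔ _
  rw [ofAdd_eq_one, ZMod.intCast_zmod_eq_zero_iff_dvd]

end Period

/-! ## §4 The symbol step -/

section StepB

variable {N : ℕ} [NeZero N] {f : CuspForm (Gamma0 N) 2} {p : ℕ} [hp : Fact p.Prime]

/-- The hypothesis REFUTED by the symbol step: every `[a/p^k]⁺_f` (`k ≥ 1`, `(a,p) = 1`) lies in `pℤ_(p)`. -/
def AllNonUnit (f : CuspForm (Gamma0 N) 2) (p : ℕ) : Prop :=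
  ∀ (k : ℕ) (a : ℤ), 0 < k → IsCoprime a (p : ℤ) →
    padicNorm p (ratPlusSymbol f ((a : ℚ) / (p : ℚ) ^ k)) < 1

/-- `R(r)·Ω⁺_f = Re {∞, r}_f` for a rational newform (`ratCast_ratPlusSymbol`, `plusSymbol_eq_re`). -/
theorem ratPlusSymbol_mul_plusPeriod (hf : IsNewform0 f) (hQ : coeffField f = ⊥) (r : ℚ) :
    ((ratPlusSymbol f r : ℚ) : ℝ) * plusPeriod f = (modularSymbol f r).re := by
  have hΩ := IsNewform0.plusPeriod_pos_holds hf hQ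
  have hrat := ratCast_ratPlusSymbol_holds hf hQ r
  have hre := plusSymbol_eq_re_holds f (cuspCoeff_im_eq_zero_of_coeffField_eq_bot hQ) r
  rw [hrat]
  unfold normalizedPlusSymbol
  rw [div_mul_cancel₀ _ hΩ.ne', hre]
  simp

/-- **Manin's relation read on plus symbols**: `R(b/d) − R(0) = k_f(γ)/2` for `γ = (a b; c d) ∈ Γ₀(N)`, `d ≠ 0`. -/
theorem ratPlusSymbol_sub_eq_kOf (hf : IsNewform0 f) (hQ : coeffField f = ⊥) (γ : Gamma0 N)
    (hd : ((γ : SL(2, ℤ)) 1 1 : ℤ) ≠ 0) :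
    ratPlusSymbol f ((((γ : SL(2, ℤ)) 0 1 : ℤ) : ℚ) / (((γ : SL(2, ℤ)) 1 1 : ℤ) : ℚ))
      - ratPlusSymbol f 0 = (kOf f γ : ℚ) / 2 := by
  have hΩ := IsNewform0.plusPeriod_pos_holds hf hQ
  have hsmul := modularSymbol_gamma0_smul_holds f γ 0 (by simpa using hd)
  simp only [mul_zero, zero_add] at hsmul
  have h1 := ratPlusSymbol_mul_plusPeriod hf hQ
    ((((γ : SL(2, ℤ)) 0 1 : ℤ) : ℚ) / (((γ : SL(2, ℤ)) 1 1 : ℤ) : ℚ))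
  have h0 := ratPlusSymbol_mul_plusPeriod hf hQ 0
  have hk := kOf_spec hΩ γ
  have hΩ0 : plusPeriod f ≠ 0 := hΩ.ne'
  have key : (((ratPlusSymbol f ((((γ : SL(2, ℤ)) 0 1 : ℤ) : ℚ) / (((γ : SL(2, ℤ)) 1 1 : ℤ) : ℚ)) : ℚ) : ℝ)
      - ((ratPlusSymbol f 0 : ℚ) : ℝ)) * plusPeriod f = ((kOf f γ : ℝ) / 2) * plusPeriod f := by
    have e1 : (modularSymbol f ((((γ : SL(2, ℤ)) 0 1 : ℤ) : ℚ) / (((γ : SL(2, ℤ)) 1 1 : ℤ) : ℚ))).re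
        = (cuspSymbol f γ).re + (modularSymbol f 0).re := by
      have := congrArg Complex.re hsmul
      simpa using this
    rw [sub_mul, h1, h0, e1, hk]; ring
  have key' := mul_right_cancel₀ hΩ0 key
  have : (((ratPlusSymbol f ((((γ : SL(2, ℤ)) 0 1 : ℤ) : ℚ) / (((γ : SL(2, ℤ)) 1 1 : ℤ) : ℚ))
      - ratPlusSymbol f 0 : ℚ)) : ℝ) = (((kOf f γ : ℚ) / 2 : ℚ) : ℝ) := by
    push_cast; exact key'
  exact_mod_cast this

/-- **Step B1**: under `AllNonUnit`, `R(0) ∈ pℤ_(p)` (Hecke at `r = 0` with `a_p = 0`, `p` odd). -/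
theorem padicNorm_ratPlusSymbol_zero_lt_one (hf : IsNewform0 f) (hQ : coeffField f = ⊥)
    (hp2 : p ≠ 2) (hpN : ¬ p ∣ N) (hap : cuspCoeff f p = 0) (hH : AllNonUnit f p) :
    padicNorm p (ratPlusSymbol f 0) < 1 := by
  haveI : NeZero p := ⟨hp.out.ne_zero⟩
  have hrat : ∀ r : ℚ, (ratPlusSymbol f r : ℝ) = normalizedPlusSymbol f r :=
    fun r => ratCast_ratPlusSymbol_holds hf hQ r
  have hap' : cuspCoeff f p = ((0 : ℤ) : ℂ) := by rw [hap]; simp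
  have hHecke := intCast_mul_ratPlusSymbol p hf hp.out hpN hap' hrat 0
  simp only [Int.cast_zero, zero_mul, zero_add, mul_zero] at hHecke
  rw [← Finset.add_sum_erase Finset.univ _ (Finset.mem_univ (0 : Fin p))] at hHecke
  simp only [Fin.val_zero, Nat.cast_zero, zero_div] at hHecke
  -- hHecke : 0 = R 0 + ∑_{j ≠ 0} R (j/p) + R 0
  have hS : padicNorm p (∑ j ∈ Finset.univ.erase (0 : Fin p),
      ratPlusSymbol f (((j : ℕ) : ℚ) / (p : ℚ))) < 1 := by
    apply padicNorm_sum_lt_one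
    intro j hj
    have hj0 : (j : ℕ) ≠ 0 := by
      intro h
      exact (Finset.mem_erase.mp hj).1 (Fin.ext (by rw [h]; simp))
    have hcop : IsCoprime ((j : ℕ) : ℤ) (p : ℤ) :=
      Nat.isCoprime_iff_coprime.mpr
        (((Nat.Prime.coprime_iff_not_dvd hp.out).mpr
          (Nat.not_dvd_of_pos_of_lt (Nat.pos_of_ne_zero hj0) j.isLt)).symm)
    have := hH 1 ((j : ℕ) : ℤ) one_pos hcop
    simpa using this
  have h2 : (2 : ℚ) * ratPlusSymbol f 0 = -(∑ j ∈ Finset.univ.erase (0 : Fin p),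
      ratPlusSymbol f (((j : ℕ) : ℚ) / (p : ℚ))) := by linarith
  have h3 : padicNorm p ((2 : ℚ) * ratPlusSymbol f 0) < 1 := by
    rw [h2, padicNorm.neg]; exact hS
  rwa [padicNorm.mul, padicNorm_two hp2, one_mul] at h3

/-- **Step B3**: under `AllNonUnit`, `p ∣ k_f(γ)` for every `γ ∈ S_p` (`d = ±p^e`: `R(b/d) ∈ pℤ_(p)` by
hypothesis if `e ≥ 1`, `= R(0)` if `e = 0`). -/
theorem dvd_kOf_of_mem_pPowerCuspSet (hf : IsNewform0 f) (hQ : coeffField f = ⊥)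
    (hp2 : p ≠ 2) (hR0 : padicNorm p (ratPlusSymbol f 0) < 1) (hH : AllNonUnit f p)
    (γ : Gamma0 N) (hγ : (γ : SL(2, ℤ)) ∈ pPowerCuspSet N p) : (p : ℤ) ∣ kOf f γ := by
  obtain ⟨-, e, he⟩ := hγ
  have hdet := Matrix.SpecialLinearGroup.det_coe (γ : SL(2, ℤ))
  rw [Matrix.det_fin_two] at hdet
  have hpe : ((p : ℤ) ^ e) ≠ 0 := pow_ne_zero _ (by exact_mod_cast hp.out.ne_zero)
  have hd0 : ((γ : SL(2, ℤ)) 1 1 : ℤ) ≠ 0 := by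
    rcases he with h | h
    · rw [show ((γ : SL(2, ℤ)) 1 1 : ℤ) = (p : ℤ) ^ e from h]; exact hpe
    · rw [show ((γ : SL(2, ℤ)) 1 1 : ℤ) = -((p : ℤ) ^ e) from h]; exact neg_ne_zero.mpr hpe
  have hdiff := ratPlusSymbol_sub_eq_kOf hf hQ γ hd0
  -- |R(b/d)|_p < 1
  have hR : padicNorm p (ratPlusSymbol f ((((γ : SL(2, ℤ)) 0 1 : ℤ) : ℚ) /
      (((γ : SL(2, ℤ)) 1 1 : ℤ) : ℚ))) < 1 := by
    rcases Nat.eq_zero_or_pos e with he0 | he0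
    · -- d = ±1: the symbol is R(±b) = R(0)
      rcases he with h | h
      · have hd1 : ((γ : SL(2, ℤ)) 1 1 : ℤ) = 1 := by
          rw [show ((γ : SL(2, ℤ)) 1 1 : ℤ) = (p : ℤ) ^ e from h, he0, pow_zero]
        have := ratPlusSymbol_add_intCast_eq f 0 ((γ : SL(2, ℤ)) 0 1 : ℤ)
        rw [zero_add] at this
        rw [hd1, Int.cast_one, div_one, this]; exact hR0
      · have hd1 : ((γ : SL(2, ℤ)) 1 1 : ℤ) = -1 := by
          rw [show ((γ : SL(2, ℤ)) 1 1 : ℤ) = -((p : ℤ) ^ e) from h, he0, pow_zero]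
        have := ratPlusSymbol_add_intCast_eq f 0 (-((γ : SL(2, ℤ)) 0 1 : ℤ))
        rw [zero_add] at this
        have e1 : ((((γ : SL(2, ℤ)) 0 1 : ℤ) : ℚ) / (((-1 : ℤ)) : ℚ)) = (((-((γ : SL(2, ℤ)) 0 1 : ℤ)) : ℤ) : ℚ) := by
          push_cast; ring
        rw [hd1, e1, this]; exact hR0
    · rcases he with h | h
      · have hcop : IsCoprime ((γ : SL(2, ℤ)) 0 1 : ℤ) (p : ℤ) := by
          have hbd : IsCoprime ((γ : SL(2, ℤ)) 0 1 : ℤ) ((p : ℤ) ^ e) :=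
            ⟨-((γ : SL(2, ℤ)) 1 0 : ℤ), ((γ : SL(2, ℤ)) 0 0 : ℤ), by
              rw [← show ((γ : SL(2, ℤ)) 1 1 : ℤ) = (p : ℤ) ^ e from h]; linear_combination hdet⟩
          exact (IsCoprime.pow_right_iff he0).mp hbd
        have := hH e _ he0 hcop
        rw [show ((γ : SL(2, ℤ)) 1 1 : ℤ) = (p : ℤ) ^ e from h]; push_cast; exact this
      · have hcop : IsCoprime (-((γ : SL(2, ℤ)) 0 1 : ℤ)) (p : ℤ) := by
          have hbd : IsCoprime ((γ : SL(2, ℤ)) 0 1 : ℤ) ((p : ℤ) ^ e) :=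
            ⟨-((γ : SL(2, ℤ)) 1 0 : ℤ), -((γ : SL(2, ℤ)) 0 0 : ℤ), by
              rw [show ((p : ℤ) ^ e) = -((γ : SL(2, ℤ)) 1 1 : ℤ) from by rw [h]; ring]
              linear_combination hdet⟩
          exact ((IsCoprime.pow_right_iff he0).mp hbd).neg_left
        have := hH e _ he0 hcop
        rw [show ((γ : SL(2, ℤ)) 1 1 : ℤ) = -((p : ℤ) ^ e) from h]
        have e1 : ((((γ : SL(2, ℤ)) 0 1 : ℤ) : ℚ) / (((-((p : ℤ) ^ e)) : ℤ) : ℚ))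
            = (((-((γ : SL(2, ℤ)) 0 1 : ℤ)) : ℤ) : ℚ) / (p : ℚ) ^ e := by
          push_cast; rw [div_neg, neg_div]
        rw [e1]; exact this
  have h := padicNorm_sub_lt_one hR hR0
  rw [hdiff] at h
  exact dvd_of_padicNorm_div_two_lt_one hp2 h

/-- **Step B4** (LEMMA′ applied to `k_f mod p`): `p ∣ k_f` on `S_p` ⟹ `p ∣ k_f` on `Γ′`. -/
theorem dvd_kOf_of_mem_gammaPrimeSet (hΩ : 0 < plusPeriod f) (hL : LemmaPrimeHom N p)
    (hS : ∀ γ : Gamma0 N, (γ : SL(2, ℤ)) ∈ pPowerCuspSet N p → (p : ℤ) ∣ kOf f γ)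
    (γ : Gamma0 N) (hγ : (γ : SL(2, ℤ)) ∈ gammaPrimeSet N p) : (p : ℤ) ∣ kOf f γ := by
  have h := hL (Multiplicative (ZMod p)) (kHomMod hΩ p)
    (fun δ hδ => (kHomMod_eq_one_iff hΩ p δ).mpr (hS δ hδ)) γ hγ
  exact (kHomMod_eq_one_iff hΩ p γ).mp h

/-- **Step B5a**: if `p ∣ k_f` on `Γ′`, then `k_f(γ) ≡ k_f(γ') (mod p)` whenever `d(γ) ≡ d(γ')·p^e (mod N)`
(`γ γ'⁻¹ ∈ Γ′`, its lower-right entry being `≡ d d'⁻¹ ≡ p^e`). -/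
theorem dvd_kOf_sub_of_apply_eq (hΩ : 0 < plusPeriod f)
    (hΓ : ∀ γ : Gamma0 N, (γ : SL(2, ℤ)) ∈ gammaPrimeSet N p → (p : ℤ) ∣ kOf f γ)
    (γ γ' : Gamma0 N) (e : ℕ)
    (h : (((γ : SL(2, ℤ)) 1 1 : ℤ) : ZMod N) = (((γ' : SL(2, ℤ)) 1 1 : ℤ) : ZMod N) * (p : ZMod N) ^ e) :
    (p : ℤ) ∣ kOf f γ - kOf f γ' := by
  have hc : (((γ : SL(2, ℤ)) 1 0 : ℤ) : ZMod N) = 0 := Gamma0_mem.mp γ.2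
  have hc' : (((γ' : SL(2, ℤ)) 1 0 : ℤ) : ZMod N) = 0 := Gamma0_mem.mp γ'.2
  have hdet' := Matrix.SpecialLinearGroup.det_coe (γ' : SL(2, ℤ))
  rw [Matrix.det_fin_two] at hdet'
  have hdetZ : (((γ' : SL(2, ℤ)) 0 0 : ℤ) : ZMod N) * (((γ' : SL(2, ℤ)) 1 1 : ℤ) : ZMod N) = 1 := by
    have h1 := congrArg (fun z : ℤ => (z : ZMod N)) hdet'
    simp only [Int.cast_sub, Int.cast_mul, Int.cast_one, hc', mul_zero, sub_zero] at h1
    exact h1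
  have hentry : (((γ * γ'⁻¹ : Gamma0 N) : SL(2, ℤ)) 1 1 : ℤ) =
      -(((γ : SL(2, ℤ)) 1 0 : ℤ) * ((γ' : SL(2, ℤ)) 0 1 : ℤ)) +
        ((γ : SL(2, ℤ)) 1 1 : ℤ) * ((γ' : SL(2, ℤ)) 0 0 : ℤ) := by
    have e1 : ((γ * γ'⁻¹ : Gamma0 N) : SL(2, ℤ)) = (γ : SL(2, ℤ)) * (γ' : SL(2, ℤ))⁻¹ := rfl
    rw [e1, Matrix.SpecialLinearGroup.SL2_inv_expl]
    simp [Matrix.mul_apply, Fin.sum_univ_two]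
  have hmem : ((γ * γ'⁻¹ : Gamma0 N) : SL(2, ℤ)) ∈ gammaPrimeSet N p := by
    refine ⟨(γ * γ'⁻¹).2, e, Or.inl ?_⟩
    show ((((γ * γ'⁻¹ : Gamma0 N) : SL(2, ℤ)) 1 1 : ℤ) : ZMod N) = (p : ZMod N) ^ e
    rw [hentry]; push_cast; rw [hc, h]
    linear_combination ((p : ZMod N) ^ e) * hdetZ
  have h2 := hΓ _ hmem
  rwa [kOf_mul hΩ, kOf_inv hΩ, ← sub_eq_add_neg] at h2

/-- **Step B5b, general `a_p`** (Hecke at `r = 1/v`): under `R(0) ∈ pℤ_(p)`, `AllNonUnit`, `p ∤ a_p − 1`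
(non-anomalous) and LEMMA′, `p ∣ k_f(γ_v)` for every `γ_v ∈ Γ₀(N)` with lower-right entry a positive integer `v`
prime to `Np`.  Covers `a_p = 0` (supersingular, THEOREM A) and `a_p ≢ 0, 1 mod p` (ordinary non-anomalous,
THEOREM A′ of critic verdict V40). -/
theorem dvd_kOf_of_apply_eq_nat_of_cuspCoeff (hf : IsNewform0 f) (hQ : coeffField f = ⊥)
    (hp2 : p ≠ 2) (hpN : ¬ p ∣ N) {ap : ℤ} (hap' : cuspCoeff f p = ap) (hap1 : ¬ (p : ℤ) ∣ ap - 1)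
    (hR0 : padicNorm p (ratPlusSymbol f 0) < 1) (hH : AllNonUnit f p)
    (hL : LemmaPrimeHom N p) (v : ℕ) (hv0 : 0 < v) (hvN : Nat.Coprime v N) (hvp : ¬ p ∣ v)
    (γv : Gamma0 N) (hγv : ((γv : SL(2, ℤ)) 1 1 : ℤ) = v) : (p : ℤ) ∣ kOf f γv := by
  haveI : NeZero p := ⟨hp.out.ne_zero⟩
  have hΩ := IsNewform0.plusPeriod_pos_holds hf hQ
  have hrat : ∀ r : ℚ, (ratPlusSymbol f r : ℝ) = normalizedPlusSymbol f r :=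
    fun r => ratCast_ratPlusSymbol_holds hf hQ r
  have hS := dvd_kOf_of_mem_pPowerCuspSet hf hQ hp2 hR0 hH
  have hΓ := dvd_kOf_of_mem_gammaPrimeSet hΩ hL hS
  have hv0Z : (v : ℤ) ≠ 0 := by exact_mod_cast hv0.ne'
  have hpZ : (p : ℤ) ≠ 0 := by exact_mod_cast hp.out.ne_zero
  have hv0Q : (v : ℚ) ≠ 0 := by exact_mod_cast hv0.ne'
  have hpQ : (p : ℚ) ≠ 0 := by exact_mod_cast hp.out.ne_zero
  have hpNZ : IsCoprime (p : ℤ) (N : ℤ) :=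
    Nat.isCoprime_iff_coprime.mpr ((Nat.Prime.coprime_iff_not_dvd hp.out).mpr hpN)
  have hvNZ : IsCoprime (v : ℤ) (N : ℤ) := Nat.isCoprime_iff_coprime.mpr hvN
  have hpvZ : IsCoprime (p : ℤ) (v : ℤ) :=
    Nat.isCoprime_iff_coprime.mpr ((Nat.Prime.coprime_iff_not_dvd hp.out).mpr hvp)
  -- every `R(s/t)`, `t = v·p^e`, `(t, sN) = 1`, is `R(0) + k_v/2 + p·m/2`
  have key : ∀ (s t : ℤ) (e : ℕ), t = v * (p : ℤ) ^ e → IsCoprime t (s * N) →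
      ∃ m : ℤ, ratPlusSymbol f ((s : ℚ) / (t : ℚ)) =
        ratPlusSymbol f 0 + (kOf f γv : ℚ) / 2 + (p : ℚ) * m / 2 := by
    intro s t e hte hcop
    obtain ⟨γ, hγb, hγd⟩ := exists_gamma0_entries N s t hcop
    have ht0 : t ≠ 0 := by rw [hte]; exact mul_ne_zero hv0Z (pow_ne_zero _ hpZ)
    have hdiff := ratPlusSymbol_sub_eq_kOf hf hQ γ (by rw [hγd]; exact ht0)
    rw [hγb, hγd] at hdiff
    have hcong : (p : ℤ) ∣ kOf f γ - kOf f γv := by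
      apply dvd_kOf_sub_of_apply_eq hΩ hΓ γ γv e
      rw [hγd, hγv, hte]; push_cast; ring
    obtain ⟨m, hm⟩ := hcong
    refine ⟨m, ?_⟩
    have hmQ : ((kOf f γ : ℤ) : ℚ) - kOf f γv = (p : ℚ) * m := by exact_mod_cast hm
    linarith [hdiff, hmQ]
  -- Hecke at r = 1/v
  have hHecke := intCast_mul_ratPlusSymbol p hf hp.out hpN hap' hrat (1 / (v : ℚ))
  -- the left-hand side R(1/v) itself
  have hlhs : ∃ m : ℤ, ratPlusSymbol f (1 / (v : ℚ)) =
      ratPlusSymbol f 0 + (kOf f γv : ℚ) / 2 + (p : ℚ) * m / 2 := by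
    have hx : (1 / (v : ℚ)) = (((1 : ℤ)) : ℚ) / ((v : ℤ) : ℚ) := by push_cast; ring
    rw [hx]
    exact key 1 v 0 (by simp) (by simpa using hvNZ)
  -- each term of the sum
  have hterm : ∀ j : Fin p, ∃ m : ℤ, ratPlusSymbol f ((1 / (v : ℚ) + ((j : ℕ) : ℚ)) / (p : ℚ)) =
      ratPlusSymbol f 0 + (kOf f γv : ℚ) / 2 + (p : ℚ) * m / 2 := by
    intro j
    have hvb : IsCoprime (v : ℤ) (1 + (j : ℕ) * v : ℤ) := ⟨-((j : ℕ) : ℤ), 1, by ring⟩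
    by_cases hdvd : (p : ℤ) ∣ (1 + (j : ℕ) * v : ℤ)
    · obtain ⟨b, hb⟩ := hdvd
      have hx : (1 / (v : ℚ) + ((j : ℕ) : ℚ)) / (p : ℚ) = ((b : ℤ) : ℚ) / ((v : ℤ) : ℚ) := by
        have hbQ : (1 : ℚ) + ((j : ℕ) : ℚ) * v = (p : ℚ) * b := by exact_mod_cast hb
        push_cast
        rw [div_add' _ _ _ hv0Q, div_div, div_eq_div_iff (mul_ne_zero hv0Q hpQ) hv0Q, hbQ]
        ring
      rw [hx]
      refine key b v 0 (by simp) ?_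
      have hvb' : IsCoprime (v : ℤ) b := by
        rw [hb] at hvb; exact hvb.of_mul_right_right
      exact hvb'.mul_right hvNZ
    · have hx : (1 / (v : ℚ) + ((j : ℕ) : ℚ)) / (p : ℚ) =
          (((1 + (j : ℕ) * v : ℤ)) : ℚ) / (((v * (p : ℤ) ^ 1 : ℤ)) : ℚ) := by
        push_cast
        rw [div_add' _ _ _ hv0Q, div_div, pow_one]
      rw [hx]
      refine key _ _ 1 rfl ?_
      have hpb : IsCoprime (p : ℤ) (1 + (j : ℕ) * v : ℤ) :=
        (Irreducible.coprime_iff_not_dvd (Nat.prime_iff_prime_int.mp hp.out).irreducible).mpr hdvd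
      rw [pow_one]
      exact (hvb.mul_left hpb).mul_right (hvNZ.mul_left hpNZ)
  -- the last term R(p/v)
  have hlast : ∃ m : ℤ, ratPlusSymbol f ((p : ℚ) * (1 / (v : ℚ))) =
      ratPlusSymbol f 0 + (kOf f γv : ℚ) / 2 + (p : ℚ) * m / 2 := by
    have hx : (p : ℚ) * (1 / (v : ℚ)) = (((p : ℤ)) : ℚ) / ((v : ℤ) : ℚ) := by push_cast; ring
    rw [hx]
    exact key p v 0 (by simp) ((hpvZ.symm).mul_right hvNZ)
  choose m hm using hterm
  obtain ⟨m', hm'⟩ := hlast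
  obtain ⟨m₀, hm₀⟩ := hlhs
  rw [hm₀, hm', Finset.sum_congr rfl (fun j _ => hm j)] at hHecke
  simp only [Finset.sum_add_distrib, Finset.sum_const, Finset.card_univ, Fintype.card_fin,
    nsmul_eq_mul] at hHecke
  -- hHecke : ap·(R0 + k/2 + p m₀/2) = (p·R0 + p·(k/2) + Σ p m_j/2) + (R0 + k/2 + p m'/2)
  have hsum : ∑ j : Fin p, (p : ℚ) * (m j : ℚ) / 2 = (p : ℚ) * ((∑ j : Fin p, m j : ℤ) : ℚ) / 2 := by
    push_cast; rw [Finset.mul_sum, Finset.sum_div]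
  rw [hsum] at hHecke
  have hmain : (((ap - p - 1 : ℤ)) : ℚ) * (ratPlusSymbol f 0 + (kOf f γv : ℚ) / 2) =
      (p : ℚ) * (((∑ j : Fin p, m j) + m' - ap * m₀ : ℤ) : ℚ) / 2 := by
    push_cast at hHecke ⊢; linarith
  have hlt : padicNorm p ((((ap - p - 1 : ℤ)) : ℚ) * (ratPlusSymbol f 0 + (kOf f γv : ℚ) / 2)) < 1 := by
    rw [hmain]; exact padicNorm_p_mul_int_div_two_lt_one hp2 _
  have hp1 : padicNorm p (((ap - p - 1 : ℤ)) : ℚ) = 1 := by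
    refine (padicNorm.int_eq_one_iff (p := p) (ap - p - 1)).mpr ?_
    intro hd
    apply hap1
    have : ap - 1 = (ap - p - 1) + p := by ring
    rw [this]
    exact dvd_add hd (dvd_refl _)
  rw [padicNorm.mul, hp1, one_mul] at hlt
  have h4 : padicNorm p ((kOf f γv : ℚ) / 2) < 1 := by
    have := padicNorm_sub_lt_one hlt hR0
    rwa [add_sub_cancel_left] at this
  exact dvd_of_padicNorm_div_two_lt_one hp2 h4

/-- **Step B5b** at `a_p = 0` (Hecke at `r = 1/v`): under `AllNonUnit` and LEMMA′, `p ∣ k_f(γ_v)`. -/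
theorem dvd_kOf_of_apply_eq_nat (hf : IsNewform0 f) (hQ : coeffField f = ⊥)
    (hp2 : p ≠ 2) (hpN : ¬ p ∣ N) (hap : cuspCoeff f p = 0) (hH : AllNonUnit f p)
    (hL : LemmaPrimeHom N p) (v : ℕ) (hv0 : 0 < v) (hvN : Nat.Coprime v N) (hvp : ¬ p ∣ v)
    (γv : Gamma0 N) (hγv : ((γv : SL(2, ℤ)) 1 1 : ℤ) = v) : (p : ℤ) ∣ kOf f γv := by
  have hap' : cuspCoeff f p = ((0 : ℤ) : ℂ) := by rw [hap]; simp
  have hR0 := padicNorm_ratPlusSymbol_zero_lt_one hf hQ hp2 hpN hap hH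
  have hap1 : ¬ (p : ℤ) ∣ (0 : ℤ) - 1 := by
    rw [zero_sub, dvd_neg]
    intro h
    exact hp.out.ne_one (by exact_mod_cast Int.eq_one_of_dvd_one (by positivity) h)
  exact dvd_kOf_of_apply_eq_nat_of_cuspCoeff hf hQ hp2 hpN hap' hap1 hR0 hH hL v hv0 hvN hvp γv hγv

/-- **THE SYMBOL STEP, general non-anomalous `a_p`** (EG-REDUCTION-g8 THEOREM A §4 and critic V40 (e) THEOREM
A′): for an odd prime `p ∤ N` and a rational newform `f` of level `N` with `a_p(f) ≢ 1 (mod p)`, LEMMA′(N,p) and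
`R(0) = [0]⁺_f ∈ pℤ_(p)` imply that NOT every `[a/p^k]⁺_f` (`k ≥ 1`, `p ∤ a`) vanishes mod `p`. -/
theorem not_allNonUnit_of_lemmaPrimeHom_of_cuspCoeff (hf : IsNewform0 f) (hQ : coeffField f = ⊥)
    (hp2 : p ≠ 2) (hpN : ¬ p ∣ N) {ap : ℤ} (hap' : cuspCoeff f p = ap) (hap1 : ¬ (p : ℤ) ∣ ap - 1)
    (hL : LemmaPrimeHom N p) (hR0 : padicNorm p (ratPlusSymbol f 0) < 1) :
    ¬ AllNonUnit f p := by
  intro hH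
  have hΩ := IsNewform0.plusPeriod_pos_holds hf hQ
  obtain ⟨γ₁, hγ₁⟩ := exists_kOf_eq_one hΩ
  -- d(γ₁) is a unit mod N
  have hdet := Matrix.SpecialLinearGroup.det_coe (γ₁ : SL(2, ℤ))
  rw [Matrix.det_fin_two] at hdet
  have hc : (((γ₁ : SL(2, ℤ)) 1 0 : ℤ) : ZMod N) = 0 := Gamma0_mem.mp γ₁.2
  have hunit : IsUnit ((((γ₁ : SL(2, ℤ)) 1 1 : ℤ)) : ZMod N) := by
    have h1 := congrArg (fun z : ℤ => (z : ZMod N)) hdet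
    simp only [Int.cast_sub, Int.cast_mul, Int.cast_one, hc, mul_zero, sub_zero] at h1
    exact IsUnit.of_mul_eq_one_right _ h1
  -- choose v > 0, v ≡ d(γ₁) mod N, p ∤ v
  obtain ⟨v0, hv0⟩ : ∃ v0 : ℕ, ((v0 : ℕ) : ZMod N) = ((((γ₁ : SL(2, ℤ)) 1 1 : ℤ)) : ZMod N) :=
    ⟨_, ZMod.natCast_zmod_val _⟩
  have hNpos : 0 < N := Nat.pos_of_ne_zero (NeZero.ne N)
  have hcand : ∀ i : ℕ, ((v0 + i * N : ℕ) : ZMod N) = ((((γ₁ : SL(2, ℤ)) 1 1 : ℤ)) : ZMod N) := by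
    intro i; push_cast; rw [ZMod.natCast_self, mul_zero, add_zero, hv0]
  obtain ⟨v, hvpos, hvd, hvp⟩ : ∃ v : ℕ, 0 < v ∧
      ((v : ℕ) : ZMod N) = ((((γ₁ : SL(2, ℤ)) 1 1 : ℤ)) : ZMod N) ∧ ¬ p ∣ v := by
    by_cases h1 : p ∣ v0 + 1 * N
    · refine ⟨v0 + 2 * N, by omega, hcand 2, fun h2 => hpN ?_⟩
      have h3 := Nat.dvd_sub h2 h1
      have e : v0 + 2 * N - (v0 + 1 * N) = N := by omega
      rwa [e] at h3
    · exact ⟨v0 + 1 * N, by omega, hcand 1, h1⟩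
  have hvN : Nat.Coprime v N := by
    have : IsUnit ((v : ℕ) : ZMod N) := by rw [hvd]; exact hunit
    exact (ZMod.isUnit_iff_coprime v N).mp this
  obtain ⟨γv, -, hγv⟩ := exists_gamma0_entries N 1 v
    (by simpa using (Nat.isCoprime_iff_coprime.mpr hvN : IsCoprime (v : ℤ) (N : ℤ)))
  have hkv := dvd_kOf_of_apply_eq_nat_of_cuspCoeff hf hQ hp2 hpN hap' hap1 hR0 hH hL v hvpos hvN hvp γv hγv
  have hS := dvd_kOf_of_mem_pPowerCuspSet hf hQ hp2 hR0 hH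
  have hΓ := dvd_kOf_of_mem_gammaPrimeSet hΩ hL hS
  have hcong := dvd_kOf_sub_of_apply_eq hΩ hΓ γ₁ γv 0
    (by rw [hγv, pow_zero, mul_one]; push_cast; exact hvd.symm)
  rw [hγ₁] at hcong
  have h1 : (p : ℤ) ∣ 1 := by
    have := dvd_add hcong hkv
    rwa [sub_add_cancel] at this
  have hp1 : (p : ℤ) = 1 := Int.eq_one_of_dvd_one (by positivity) h1
  exact hp.out.ne_one (by exact_mod_cast hp1)

/-- **THEOREM A′ symbol step (ordinary non-anomalous, critic V40 (e))**: for `p` odd, `p ∤ N`, `f` rational with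
`a_p ≢ 1 (mod p)`, LEMMA′(N,p) forbids `R(0) ∈ pℤ_(p)` together with `AllNonUnit` — which is what `μ(L_p(f)) ≥ 1`
gives in the ordinary case (`(1 − α⁻¹)² R(0) ∈ pℤ_p`, then the MTT recursion; classical, NOT formalised here). -/
theorem not_allNonUnit_and_of_lemmaPrimeHom (hf : IsNewform0 f) (hQ : coeffField f = ⊥)
    (hp2 : p ≠ 2) (hpN : ¬ p ∣ N) {ap : ℤ} (hap' : cuspCoeff f p = ap) (hap1 : ¬ (p : ℤ) ∣ ap - 1)
    (hL : LemmaPrimeHom N p) :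
    ¬ (padicNorm p (ratPlusSymbol f 0) < 1 ∧ AllNonUnit f p) :=
  fun h => not_allNonUnit_of_lemmaPrimeHom_of_cuspCoeff hf hQ hp2 hpN hap' hap1 hL h.1 h.2

/-- **THE SYMBOL STEP at `a_p = 0`** (EG-REDUCTION-g8 THEOREM A, §4): for an odd prime `p ∤ N` and a rational
newform `f` of level `N` with `a_p(f) = 0`, LEMMA′(N,p) implies that NOT every `[a/p^k]⁺_f` (`k ≥ 1`, `p ∤ a`)
vanishes mod `p` (`R(0) ∈ pℤ_(p)` is automatic here, Step B1). -/
theorem not_allNonUnit_of_lemmaPrimeHom (hf : IsNewform0 f) (hQ : coeffField f = ⊥)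
    (hp2 : p ≠ 2) (hpN : ¬ p ∣ N) (hap : cuspCoeff f p = 0) (hL : LemmaPrimeHom N p) :
    ¬ AllNonUnit f p := by
  intro hH
  have hap' : cuspCoeff f p = ((0 : ℤ) : ℂ) := by rw [hap]; simp
  have hR0 := padicNorm_ratPlusSymbol_zero_lt_one hf hQ hp2 hpN hap hH
  have hap1 : ¬ (p : ℤ) ∣ (0 : ℤ) - 1 := by
    rw [zero_sub, dvd_neg]
    intro h
    exact hp.out.ne_one (by exact_mod_cast Int.eq_one_of_dvd_one (by positivity) h)
  exact not_allNonUnit_of_lemmaPrimeHom_of_cuspCoeff hf hQ hp2 hpN hap' hap1 hL hR0 hH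

/-- From the unit-indexed form (`u` a unit of `ℤ/p^{n+1}`) to `AllNonUnit` (`ℤ`-periodicity of `[·]⁺_f`). -/
theorem allNonUnit_of_forall_units
    (h : ∀ (n : ℕ) (u : (ZMod (p ^ (n + 1)))ˣ),
      padicNorm p (ratPlusSymbol f (((u : ZMod (p ^ (n + 1))).val : ℚ) / (p : ℚ) ^ (n + 1))) < 1) :
    AllNonUnit f p := by
  intro k a hk hcop
  obtain ⟨n, rfl⟩ : ∃ n, k = n + 1 := ⟨k - 1, by omega⟩
  haveI : NeZero (p ^ (n + 1)) := ⟨pow_ne_zero _ hp.out.ne_zero⟩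
  have hu : IsUnit ((a : ℤ) : ZMod (p ^ (n + 1))) := by
    rw [ZMod.coe_int_isUnit_iff_isCoprime]
    push_cast
    exact ((IsCoprime.pow_right_iff (by omega : 0 < n + 1)).mpr hcop).symm
  obtain ⟨u, hu'⟩ := hu
  have hval : ((((u : ZMod (p ^ (n + 1))).val : ℕ)) : ℤ) = a % ((p : ℤ) ^ (n + 1)) := by
    rw [hu']
    have := ZMod.val_intCast (n := p ^ (n + 1)) a
    push_cast at this
    exact this
  have hper : ratPlusSymbol f ((a : ℚ) / (p : ℚ) ^ (n + 1)) =
      ratPlusSymbol f (((u : ZMod (p ^ (n + 1))).val : ℚ) / (p : ℚ) ^ (n + 1)) := by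
    have hpQ : (p : ℚ) ^ (n + 1) ≠ 0 := pow_ne_zero _ (by exact_mod_cast hp.out.ne_zero)
    have hdQ : (a : ℚ) = ((a % ((p : ℤ) ^ (n + 1)) : ℤ) : ℚ) +
        (p : ℚ) ^ (n + 1) * ((a / ((p : ℤ) ^ (n + 1)) : ℤ) : ℚ) := by
      have hdecomp : (a : ℤ) = a % ((p : ℤ) ^ (n + 1)) + (p : ℤ) ^ (n + 1) * (a / ((p : ℤ) ^ (n + 1))) := by
        have := Int.emod_add_mul_ediv a ((p : ℤ) ^ (n + 1)); linarith
      have := congrArg (Int.cast : ℤ → ℚ) hdecomp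
      push_cast at this
      exact this
    have e2 : ((((u : ZMod (p ^ (n + 1))).val : ℕ)) : ℚ) = ((a % ((p : ℤ) ^ (n + 1)) : ℤ) : ℚ) := by
      exact_mod_cast hval
    rw [e2, hdQ, add_div, mul_div_cancel_left₀ _ hpQ, ratPlusSymbol_add_intCast_eq]
  rw [hper]; exact h n u

end StepB

/-! ## §5 The one-sign μ-rider at `p = 3` from LEMMA′(N,3) alone -/

section Three

variable {N : ℕ} [NeZero N] {f : CuspForm (Gamma0 N) 2}

/-- **μ-rider at `p = 3` from LEMMA′.** For the newform `f` of an elliptic curve with good supersingular reduction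
at `3` (`a₃ = 0`), `LemmaPrimeHom N 3` gives a signed Pollack 3-adic `L`-function with unit content (`μ = 0` for one
sign). Inputs: the symbol step (`not_allNonUnit_of_lemmaPrimeHom`), the LEAD's landed
`SmallImageOrbitSumMuThree.norm_ratPlusSymbol_three_lt_one_of_not_hasUnitContent` (both signs without unit content ⇒
every `[u/3^{n+1}]⁺_f` vanishes mod 3) and the tree theorem `pollack_exists_plusMinusPAdicLFunction_holds`. -/
theorem exists_sign_hasUnitContent_three_of_lemmaPrimeHom {W : WeierstrassCurve ℚ} [W.IsElliptic]
    [W.IsGloballyMinimal] (hf : IsNewformOf W f) (hgood : W.HasGoodReductionAtPrime 3)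
    (hap : W.frobeniusTrace 3 = 0) (hL : LemmaPrimeHom N 3) :
    ∃ (ε : ℤˣ) (L : IwasawaAlgebra 3), IsSignedPAdicLFunction f 3 ε L ∧ HasUnitContent L := by
  have h32 : (3 : ℕ) ≠ 2 := by decide
  have h3N : ¬ 3 ∣ N := not_dvd_level_of_isNewformOf hf hgood
  have hap' : cuspCoeff f 3 = ((0 : ℤ) : ℂ) := by
    rw [cuspCoeff_eq_frobeniusTrace_of_isNewformOf_holds hf hgood, hap]
  have hap0 : cuspCoeff f 3 = 0 := by rw [hap']; simp
  by_contra hne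
  push_neg at hne
  -- both signed functions exist (Pollack, tree theorem) and, by `hne`, neither has unit content
  have hsym : ∀ (n : ℕ) (u : (ZMod (3 ^ (n + 1)))ˣ),
      padicNorm 3 (ratPlusSymbol f (((u : ZMod (3 ^ (n + 1))).val : ℚ) / (3 : ℚ) ^ (n + 1))) < 1 := by
    intro n u
    have hε : ∃ ε : ℤˣ, (Even n ∧ ε = 1) ∨ (Odd n ∧ ε = -1) := by
      rcases Nat.even_or_odd n with hn | hn
      · exact ⟨1, Or.inl ⟨hn, rfl⟩⟩
      · exact ⟨-1, Or.inr ⟨hn, rfl⟩⟩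
    obtain ⟨ε, hε⟩ := hε
    obtain ⟨L, -, hL'⟩ :=
      exists_isSignedPAdicLFunction (pollack_exists_plusMinusPAdicLFunction_holds) h32 hf hgood hap ε
    have hlt := Summit.BirchSwinnertonDyer.BirchSwinnertonDyer.Theorems.SmallImageOrbitSumMuThree.norm_ratPlusSymbol_three_lt_one_of_not_hasUnitContent
      f hf.1 h3N hap' hε hL' (hne ε L hL') u
    rw [Padic.eq_padicNorm] at hlt
    exact_mod_cast hlt
  exact not_allNonUnit_of_lemmaPrimeHom hf.1 hf.coeffField_eq_bot h32 h3N hap0 hL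
    (allNonUnit_of_forall_units hsym)

/-- **The v6 rider `stub_muOneSign_ns_three` of line `birth_acns`, in its `∃ ε₀ L₀` form, from the single
group-theoretic input `∀ N, ¬ 3 ∣ N → LemmaPrimeHom N 3`** (binders verbatim from the skeleton; `ClassX7 W 3` supplies
good reduction at 3; `¬ HasCM`, `¬ Surj` unused). Reshape suggestion for LEAD slh-p3 (v7): stub :=
`∀ N : ℕ, ¬ 3 ∣ N → LemmaPrimeHom N 3`, composition := this theorem. -/
theorem muOneSign_ns_three_of_lemmaPrimeHom (hL3 : ∀ N : ℕ, ¬ 3 ∣ N → LemmaPrimeHom N 3) :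
    ∀ (W : WeierstrassCurve ℚ) [W.IsElliptic] [W.IsGloballyMinimal],
    ClassX7 W 3 → ¬ W.HasCM → W.frobeniusTrace 3 = 0 → ¬ Surj W 3 →
    ∀ [NeZero (W.conductorNorm ℤ)] (f : CuspForm (Gamma0 (W.conductorNorm ℤ)) 2),
    IsNewformOf W f → ∃ (ε₀ : ℤˣ) (L₀ : IwasawaAlgebra 3),
      IsSignedPAdicLFunction f 3 ε₀ L₀ ∧ HasUnitContent L₀ := by
  intro W _ _ hX _ hap _ _ f hf
  exact exists_sign_hasUnitContent_three_of_lemmaPrimeHom hf hX.1.1 hap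
    (hL3 _ (not_dvd_level_of_isNewformOf hf hX.1.1))

/-- **Unit-symbol form** (general level): `LemmaPrimeHom N 3` ⟹ SOME `[u/3^{n+1}]⁺_f` (`u` a unit mod `3^{n+1}`) is a
3-adic UNIT — the symbol step combined with the tree's integrality `norm_ratPlusSymbol_div_pow_le_one`
(`[a/p^k]⁺ ∈ ℤ_(p)` for `p` odd, `p ∤ N`, `a_p = 0`; Pollack 2003 Thm. 5.6 / Stevens). -/
theorem exists_norm_ratPlusSymbol_three_eq_one_of_lemmaPrimeHom (hf : IsNewform0 f) (hQ : coeffField f = ⊥)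
    (h3N : ¬ 3 ∣ N) (hap : cuspCoeff f 3 = 0) (hL : LemmaPrimeHom N 3) :
    ∃ (n : ℕ) (u : (ZMod (3 ^ (n + 1)))ˣ),
      ‖((ratPlusSymbol f (((u : ZMod (3 ^ (n + 1))).val : ℚ) / (3 : ℚ) ^ (n + 1)) : ℚ) : ℚ_[3])‖ = 1 := by
  have h32 : (3 : ℕ) ≠ 2 := by decide
  have hap' : cuspCoeff f 3 = ((0 : ℤ) : ℂ) := by rw [hap]; simp
  by_contra hne
  push_neg at hne
  have hsym : ∀ (n : ℕ) (u : (ZMod (3 ^ (n + 1)))ˣ),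
      padicNorm 3 (ratPlusSymbol f (((u : ZMod (3 ^ (n + 1))).val : ℚ) / (3 : ℚ) ^ (n + 1))) < 1 := by
    intro n u
    have hle := norm_ratPlusSymbol_div_pow_le_one (f := f) h32 hf h3N hap' ((u : ZMod (3 ^ (n + 1))).val) (n + 1)
    have hlt : ‖((ratPlusSymbol f (((u : ZMod (3 ^ (n + 1))).val : ℚ) / (3 : ℚ) ^ (n + 1)) : ℚ) : ℚ_[3])‖ < 1 :=
      lt_of_le_of_ne (by exact_mod_cast hle) (hne n u)
    rw [Padic.eq_padicNorm] at hlt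
    exact_mod_cast hlt
  exact not_allNonUnit_of_lemmaPrimeHom hf hQ h32 h3N hap hL (allNonUnit_of_forall_units hsym)

/-- **The v6 stub `stub_muOneSign_ns_three` of line `birth_acns` EXACTLY AS TYPED (unit plus symbol form), from the
single group-theoretic input `∀ N, ¬ 3 ∣ N → LemmaPrimeHom N 3`** (binders verbatim from the skeleton). With this,
the LEAD may keep v6 and add `stub_lemmaPrimeHom_three : ∀ N : ℕ, ¬ 3 ∣ N → LemmaPrimeHom N 3`, closing
`stub_muOneSign_ns_three := stub_muOneSign_ns_three_of_lemmaPrimeHom stub_lemmaPrimeHom_three`. -/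
theorem stub_muOneSign_ns_three_of_lemmaPrimeHom (hL3 : ∀ N : ℕ, ¬ 3 ∣ N → LemmaPrimeHom N 3) :
    ∀ (W : WeierstrassCurve ℚ) [W.IsElliptic] [W.IsGloballyMinimal],
    ClassX7 W 3 → ¬ W.HasCM → W.frobeniusTrace 3 = 0 → ¬ Surj W 3 →
    ∀ [NeZero (W.conductorNorm ℤ)] (f : CuspForm (Gamma0 (W.conductorNorm ℤ)) 2),
    IsNewformOf W f → ∃ (n : ℕ) (u : (ZMod (3 ^ (n + 1)))ˣ),
      ‖((ratPlusSymbol f (((u : ZMod (3 ^ (n + 1))).val : ℚ) / (3 : ℚ) ^ (n + 1)) : ℚ) : ℚ_[3])‖ = 1 := by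
  intro W _ _ hX _ hap _ _ f hf
  have h3N := not_dvd_level_of_isNewformOf hf hX.1.1
  have hap0 : cuspCoeff f 3 = 0 := by
    rw [cuspCoeff_eq_frobeniusTrace_of_isNewformOf_holds hf hX.1.1, hap]; simp
  exact exists_norm_ratPlusSymbol_three_eq_one_of_lemmaPrimeHom hf.1 hf.coeffField_eq_bot h3N hap0 (hL3 _ h3N)

end Three

end Summit.BirchSwinnertonDyer.BirchSwinnertonDyer.Cruxes.KobayashiMainConjectureSmallImage.EGLine


/-!
# Crux `KobayashiMainConjectureSmallImage` (item stmt-BirchSwinnertonDyer-19002) — ideator bsd-idea-13, gen 9: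
# LEMMA′(N,p) from Vaserstein–Liehl relative elementary generation (EG-REFEREE-g9 §1), typed
# (UNREGISTERED workfile, not a line; W-79)

WHAT. `EG-REFEREE-g9.md` §1 reduces LEMMA′(N,p) (`LemmaPrimeHom N p`: every hom `Γ₀(N) → A`, `A` abelian, killing
the ±p-power-cusp set `S_p = {d = ±p^k}` kills `Γ′ = {d ≡ ±p^k mod N}`) to ONE published theorem:

(VL) [Vaserstein 1972, Mat. Sb. 89; Liehl 1981, J. reine angew. Math. 323; as stated in arXiv:1412.0953 Thm 2.1 and
arXiv:2404.01449 Thm 4.1]: for `A = ℤ[1/p]` and the ideal `N·A`, the group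
`G(A, N·A) = {g ∈ SL₂(A) : g ≡ (1 *; 0 1) mod N}` is generated by the elementary matrices `(1 x; 0 1)`, `x ∈ A`,
and `(1 0; y 1)`, `y ∈ N·A`.  Here it is the named Prop `VasersteinLiehl p N` (a HYPOTHESIS, never asserted).

THIS FILE (sorry-free, axioms = {propext, Classical.choice, Quot.sound}): the S-arithmetic set-up over the concrete subring `ZInv p = ℤ[1/p] ⊂ ℚ`, the groups
`Δ′ ⊇ B⁺, B⁻, ι(Γ′)`, the facts (S) `Γ′ ∩ B⁺B⁻ = S_p`, (V) `Γ′ ∩ B⁻ ⊆ S`, `closure(B⁺ ∪ B⁻) = Δ′ ⟸ (VL)`, the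
kernel coset lemma (re-proved here verbatim from `EGCosetLemma.lean`, since crux workfiles are not importable), and
the deduction

  `lemmaPrimeHom_of_VL : VasersteinLiehl p N → TransMinus p N → TransPlus p N → LemmaPrimeHom N p`

where `TransMinus`/`TransPlus` are the two transversality statements (T∓) `Δ′ = ι(Γ′)·B∓` of the memo, and
(Part 2, §5) PROOFS of both (reduced fractions of `g·0`, `g·∞`; gcd a power of `p`; Euler in `ZMod N`), giving

  `lemmaPrimeHom_of_vasersteinLiehl : p.Coprime N → VasersteinLiehl p N → LemmaPrimeHom N p`   (N ≥ 1)
  `lemmaPrimeHom_three_of_vasersteinLiehl : (∀ N, ¬3∣N → VasersteinLiehl 3 N) → ∀ N, ¬3∣N → LemmaPrimeHom N 3`.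

HONEST SCOPE. Sorry-free. Proves no route item; (VL) is a HYPOTHESIS (published theorem, cite above), (T±) are
PROVED here. Combined with `EGSymbolStep_g9.lean` (this seat) and `Theorems/…OrbitSumMuThree.lean` (LEAD slh-p3):
`(∀ N, ¬3∣N → VasersteinLiehl 3 N) → stub_muOneSign_ns_three` of `Lines/birth_acns.lean` v6, i.e. THEOREM A at p = 3
(min(μ₃⁺, μ₃⁻) = 0 for every rational newform with 3 ∤ N, a₃ = 0) is kernel-checked modulo the single published
input (VL). BSD is not proved by this seat; crux 4 stays OPEN.
-/

set_option autoImplicit false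
set_option linter.unusedVariables false
set_option linter.unusedSectionVars false
set_option linter.dupNamespace false

open scoped MatrixGroups

namespace Summit.BirchSwinnertonDyer.BirchSwinnertonDyer.Cruxes.KobayashiMainConjectureSmallImage.EGLemmaPrime

open CongruenceSubgroup Subgroup

/-! ## §0 The sets of `EGSketch_g8` / `EGSymbolStep_g9` (verbatim) -/

/-- `S_p`: elements of `Γ₀(N)` whose lower-right entry is `± p^k`. -/
def pPowerCuspSet (N p : ℕ) : Set SL(2, ℤ) :=
  {γ | γ ∈ Gamma0 N ∧ ∃ k : ℕ, ((γ : Matrix (Fin 2) (Fin 2) ℤ) 1 1 = (p : ℤ) ^ k ∨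
    (γ : Matrix (Fin 2) (Fin 2) ℤ) 1 1 = -((p : ℤ) ^ k))}

/-- `Γ′`: elements of `Γ₀(N)` whose lower-right entry is `≡ ± p^k (mod N)`. -/
def gammaPrimeSet (N p : ℕ) : Set SL(2, ℤ) :=
  {γ | γ ∈ Gamma0 N ∧ ∃ k : ℕ, (((γ : Matrix (Fin 2) (Fin 2) ℤ) 1 1 : ℤ) : ZMod N) = (p : ZMod N) ^ k ∨
    (((γ : Matrix (Fin 2) (Fin 2) ℤ) 1 1 : ℤ) : ZMod N) = -((p : ZMod N) ^ k)}

/-- LEMMA′ in homomorphism form: a hom to an abelian group killing `S_p` kills `Γ′`. -/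
def LemmaPrimeHom (N p : ℕ) : Prop :=
  ∀ (A : Type) [CommGroup A] (ψ : Gamma0 N →* A),
    (∀ γ : Gamma0 N, (γ : SL(2, ℤ)) ∈ pPowerCuspSet N p → ψ γ = 1) →
    ∀ γ : Gamma0 N, (γ : SL(2, ℤ)) ∈ gammaPrimeSet N p → ψ γ = 1

/-! ## §1 The coset lemma (verbatim from `EGCosetLemma.lean`, kernel-checked there; re-proved here) -/

section Coset

variable {G : Type*} [Group G]

/-- The "big cell" generating set `S = Γ ∩ B⁺·B⁻`. -/
def bigCellSet (Bp Bm Γ : Subgroup G) : Set G :=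
  {γ | γ ∈ Γ ∧ ∃ u ∈ Bp, ∃ v ∈ Bm, γ = u * v}

theorem closure_bigCellSet_le (Bp Bm Γ : Subgroup G) : Subgroup.closure (bigCellSet Bp Bm Γ) ≤ Γ :=
  (Subgroup.closure_le _).mpr fun _ h => h.1

/-- One step of the coset walk. -/
theorem step (Bp Bm Γ : Subgroup G)
    (hTm : ∀ g : G, ∃ γ ∈ Γ, ∃ b ∈ Bm, g = γ * b) (hTp : ∀ g : G, ∃ γ ∈ Γ, ∃ b ∈ Bp, g = γ * b)
    (x y : G) (hy : y ∈ Bp ∨ y ∈ Bm)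
    (ih : (∃ h ∈ Subgroup.closure (bigCellSet Bp Bm Γ), h⁻¹ * x ∈ Bm) ∧
      (∃ h ∈ Subgroup.closure (bigCellSet Bp Bm Γ), h⁻¹ * x ∈ Bp)) :
    (∃ h ∈ Subgroup.closure (bigCellSet Bp Bm Γ), h⁻¹ * (x * y) ∈ Bm) ∧
      (∃ h ∈ Subgroup.closure (bigCellSet Bp Bm Γ), h⁻¹ * (x * y) ∈ Bp) := by
  obtain ⟨⟨hm, hhm, hxm⟩, ⟨hp, hhp, hxp⟩⟩ := ih
  have key : ∀ z : G, (∃ h ∈ Subgroup.closure (bigCellSet Bp Bm Γ), h⁻¹ * z ∈ Bp) →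
      (∃ h ∈ Subgroup.closure (bigCellSet Bp Bm Γ), h⁻¹ * z ∈ Bm) := by
    intro z ⟨h, hh, hz⟩
    obtain ⟨γ, hγ, b, hb, hγb⟩ := hTm (h⁻¹ * z)
    -- γ = (h⁻¹ z) b⁻¹ ∈ Γ, and γ = u * v with u = h⁻¹ z ∈ Bp, v = b⁻¹ ∈ Bm: γ ∈ S
    have hγS : γ ∈ bigCellSet Bp Bm Γ := by
      refine ⟨hγ, h⁻¹ * z, hz, b⁻¹, Bm.inv_mem hb, ?_⟩
      rw [hγb]; group
    refine ⟨h * γ, (Subgroup.closure _).mul_mem hh (Subgroup.subset_closure hγS), ?_⟩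
    have : (h * γ)⁻¹ * z = b := by rw [mul_inv_rev, mul_assoc, hγb]; group
    rw [this]; exact hb
  have key' : ∀ z : G, (∃ h ∈ Subgroup.closure (bigCellSet Bp Bm Γ), h⁻¹ * z ∈ Bm) →
      (∃ h ∈ Subgroup.closure (bigCellSet Bp Bm Γ), h⁻¹ * z ∈ Bp) := by
    intro z ⟨h, hh, hz⟩
    obtain ⟨γ, hγ, b, hb, hγb⟩ := hTp (h⁻¹ * z)
    -- γ⁻¹ = b (h⁻¹ z)⁻¹ = b * (z⁻¹ h): γ⁻¹ ∈ Γ and γ⁻¹ = u v with u = b ∈ Bp, v = (h⁻¹ z)⁻¹ ∈ Bm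
    have hγS : γ⁻¹ ∈ bigCellSet Bp Bm Γ := by
      refine ⟨Γ.inv_mem hγ, b, hb, (h⁻¹ * z)⁻¹, Bm.inv_mem hz, ?_⟩
      rw [hγb]; group
    refine ⟨h * γ, (Subgroup.closure _).mul_mem hh ?_, ?_⟩
    · have := (Subgroup.closure (bigCellSet Bp Bm Γ)).inv_mem (Subgroup.subset_closure hγS)
      rwa [inv_inv] at this
    have : (h * γ)⁻¹ * z = b := by rw [mul_inv_rev, mul_assoc, hγb]; group
    rw [this]; exact hb
  rcases hy with hy | hy
  · -- y ∈ Bp: use the Bp-representative of x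
    have hP : ∃ h ∈ Subgroup.closure (bigCellSet Bp Bm Γ), h⁻¹ * (x * y) ∈ Bp :=
      ⟨hp, hhp, by rw [← mul_assoc]; exact Bp.mul_mem hxp hy⟩
    exact ⟨key _ hP, hP⟩
  · have hM : ∃ h ∈ Subgroup.closure (bigCellSet Bp Bm Γ), h⁻¹ * (x * y) ∈ Bm :=
      ⟨hm, hhm, by rw [← mul_assoc]; exact Bm.mul_mem hxm hy⟩
    exact ⟨hM, key' _ hM⟩

theorem exists_mem_closure_inv_mul_mem (Bp Bm Γ : Subgroup G)
    (hgen : Subgroup.closure ((Bp : Set G) ∪ (Bm : Set G)) = ⊤)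
    (hTm : ∀ g : G, ∃ γ ∈ Γ, ∃ b ∈ Bm, g = γ * b) (hTp : ∀ g : G, ∃ γ ∈ Γ, ∃ b ∈ Bp, g = γ * b)
    (g : G) :
    (∃ h ∈ Subgroup.closure (bigCellSet Bp Bm Γ), h⁻¹ * g ∈ Bm) ∧
      (∃ h ∈ Subgroup.closure (bigCellSet Bp Bm Γ), h⁻¹ * g ∈ Bp) := by
  have hg : g ∈ Subgroup.closure ((Bp : Set G) ∪ (Bm : Set G)) := by rw [hgen]; exact mem_top g
  induction hg using Subgroup.closure_induction_right with
  | one =>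
      exact ⟨⟨1, (Subgroup.closure _).one_mem, by simp⟩,
             ⟨1, (Subgroup.closure _).one_mem, by simp⟩⟩
  | mul_right x hx y hy ih => exact step Bp Bm Γ hTm hTp x y hy ih
  | mul_inv_cancel x hx y hy ih =>
      refine step Bp Bm Γ hTm hTp x y⁻¹ ?_ ih
      rcases hy with hy | hy
      · exact Or.inl (Bp.inv_mem hy)
      · exact Or.inr (Bm.inv_mem hy)

/-- **EG coset lemma** (as in `EGCosetLemma.lean`): if `Γ ∩ B⁻ ≤ Subgroup.closure S` then `Γ = Subgroup.closure S`. -/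
theorem eq_closure_bigCellSet (Bp Bm Γ : Subgroup G)
    (hgen : Subgroup.closure ((Bp : Set G) ∪ (Bm : Set G)) = ⊤)
    (hTm : ∀ g : G, ∃ γ ∈ Γ, ∃ b ∈ Bm, g = γ * b)
    (hTp : ∀ g : G, ∃ γ ∈ Γ, ∃ b ∈ Bp, g = γ * b)
    (hstab : Γ ⊓ Bm ≤ Subgroup.closure (bigCellSet Bp Bm Γ)) :
    Γ = Subgroup.closure (bigCellSet Bp Bm Γ) := by
  refine le_antisymm ?_ (closure_bigCellSet_le Bp Bm Γ)
  intro γ hγ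
  obtain ⟨⟨h, hh, hb⟩, -⟩ := exists_mem_closure_inv_mul_mem Bp Bm Γ hgen hTm hTp γ
  have hΓ : h⁻¹ * γ ∈ Γ := Γ.mul_mem (Γ.inv_mem (closure_bigCellSet_le Bp Bm Γ hh)) hγ
  have hH : h⁻¹ * γ ∈ Subgroup.closure (bigCellSet Bp Bm Γ) := hstab ⟨hΓ, hb⟩
  have : γ = h * (h⁻¹ * γ) := by group
  rw [this]
  exact (Subgroup.closure _).mul_mem hh hH

end Coset

/-! ## §2 The ring `ℤ[1/p] ⊂ ℚ` and the predicates "`∈ N·ℤ[1/p]`", "`≡ ±p^ℤ mod N`" -/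

section Ring

variable (p : ℕ) [hp : Fact p.Prime]

/-- `ℤ[1/p]` as a subring of `ℚ`. -/
def ZInv : Subring ℚ where
  carrier := {q | ∃ (n : ℕ) (a : ℤ), q = (a : ℚ) / (p : ℚ) ^ n}
  mul_mem' := by
    rintro x y ⟨n, a, rfl⟩ ⟨m, b, rfl⟩
    refine ⟨n + m, a * b, ?_⟩
    have hpn : (p : ℚ) ^ n ≠ 0 := pow_ne_zero _ (by exact_mod_cast hp.out.ne_zero)
    have hpm : (p : ℚ) ^ m ≠ 0 := pow_ne_zero _ (by exact_mod_cast hp.out.ne_zero)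
    push_cast; rw [pow_add, div_mul_div_comm]
  one_mem' := ⟨0, 1, by simp⟩
  add_mem' := by
    rintro x y ⟨n, a, rfl⟩ ⟨m, b, rfl⟩
    refine ⟨n + m, a * (p : ℤ) ^ m + b * (p : ℤ) ^ n, ?_⟩
    have hpn : (p : ℚ) ^ n ≠ 0 := pow_ne_zero _ (by exact_mod_cast hp.out.ne_zero)
    have hpm : (p : ℚ) ^ m ≠ 0 := pow_ne_zero _ (by exact_mod_cast hp.out.ne_zero)
    rw [div_add_div _ _ hpn hpm]; push_cast; rw [pow_add]; ring
  zero_mem' := ⟨0, 0, by simp⟩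
  neg_mem' := by
    rintro x ⟨n, a, rfl⟩
    exact ⟨n, -a, by push_cast; rw [neg_div]⟩

theorem mem_ZInv_iff (q : ℚ) : q ∈ ZInv p ↔ ∃ (n : ℕ) (a : ℤ), q = (a : ℚ) / (p : ℚ) ^ n := Iff.rfl

theorem intCast_mem_ZInv (a : ℤ) : (a : ℚ) ∈ ZInv p := ⟨0, a, by simp⟩

theorem pow_inv_mem_ZInv (k : ℕ) : ((p : ℚ) ^ k)⁻¹ ∈ ZInv p := ⟨k, 1, by simp⟩

variable (N : ℕ)

/-- `x ∈ N·ℤ[1/p]`. -/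
def InNR (x : ℚ) : Prop := ∃ (n : ℕ) (t : ℤ), x = (N : ℚ) * t / (p : ℚ) ^ n

/-- `x ≡ ± p^ℤ (mod N·ℤ[1/p])`, written without negative exponents: `x·p^k − ε·p^j ∈ N·ℤ[1/p]`. -/
def DCond (x : ℚ) : Prop :=
  ∃ (k j : ℕ) (ε : ℤ), (ε = 1 ∨ ε = -1) ∧ InNR p N (x * (p : ℚ) ^ k - ε * (p : ℚ) ^ j)

variable {p N}

theorem InNR.zero : InNR p N 0 := ⟨0, 0, by simp⟩

theorem InNR.add {x y : ℚ} (hx : InNR p N x) (hy : InNR p N y) : InNR p N (x + y) := by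
  obtain ⟨n, t, rfl⟩ := hx
  obtain ⟨m, s, rfl⟩ := hy
  refine ⟨n + m, t * (p : ℤ) ^ m + s * (p : ℤ) ^ n, ?_⟩
  have hpn : (p : ℚ) ^ n ≠ 0 := pow_ne_zero _ (by exact_mod_cast hp.out.ne_zero)
  have hpm : (p : ℚ) ^ m ≠ 0 := pow_ne_zero _ (by exact_mod_cast hp.out.ne_zero)
  rw [div_add_div _ _ hpn hpm]; push_cast; rw [pow_add]; ring

theorem InNR.neg {x : ℚ} (hx : InNR p N x) : InNR p N (-x) := by
  obtain ⟨n, t, rfl⟩ := hx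
  exact ⟨n, -t, by push_cast; ring⟩

theorem InNR.sub {x y : ℚ} (hx : InNR p N x) (hy : InNR p N y) : InNR p N (x - y) := by
  rw [sub_eq_add_neg]; exact hx.add hy.neg

theorem InNR.mul_mem {x y : ℚ} (hx : InNR p N x) (hy : y ∈ ZInv p) : InNR p N (x * y) := by
  obtain ⟨n, t, rfl⟩ := hx
  obtain ⟨m, a, rfl⟩ := hy
  refine ⟨n + m, t * a, ?_⟩
  push_cast; rw [pow_add, div_mul_div_comm, mul_assoc]

theorem InNR.mem_mul {x y : ℚ} (hx : x ∈ ZInv p) (hy : InNR p N y) : InNR p N (x * y) := by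
  rw [mul_comm]; exact hy.mul_mem hx

theorem InNR.of_dvd {c : ℤ} (h : (N : ℤ) ∣ c) : InNR p N (c : ℚ) := by
  obtain ⟨t, rfl⟩ := h
  exact ⟨0, t, by push_cast; simp⟩

theorem DCond.one : DCond p N 1 := ⟨0, 0, 1, Or.inl rfl, by simpa using (InNR.zero : InNR p N 0)⟩

theorem DCond.mul {x y : ℚ} (hx : DCond p N x) (hy : DCond p N y) (hxR : x ∈ ZInv p) (hyR : y ∈ ZInv p) :
    DCond p N (x * y) := by
  obtain ⟨k, j, ε, hε, hX⟩ := hx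
  obtain ⟨k', j', ε', hε', hY⟩ := hy
  refine ⟨k + k', j + j', ε * ε', ?_, ?_⟩
  · rcases hε with rfl | rfl <;> rcases hε' with rfl | rfl <;> simp
  · -- x y p^{k+k'} − εε' p^{j+j'} = (x p^k − ε p^j)·(y p^{k'}) + ε p^j·(y p^{k'} − ε' p^{j'})
    have h1 : InNR p N ((x * (p : ℚ) ^ k - ε * (p : ℚ) ^ j) * (y * (p : ℚ) ^ k')) :=
      hX.mul_mem ((ZInv p).mul_mem hyR ((ZInv p).pow_mem (by exact_mod_cast intCast_mem_ZInv p p) k'))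
    have h2 : InNR p N ((ε * (p : ℚ) ^ j) * (y * (p : ℚ) ^ k' - ε' * (p : ℚ) ^ j')) :=
      InNR.mem_mul ((ZInv p).mul_mem (by exact_mod_cast intCast_mem_ZInv p ε)
        ((ZInv p).pow_mem (by exact_mod_cast intCast_mem_ZInv p p) j)) hY
    have := h1.add h2
    push_cast
    convert this using 1
    ring

theorem DCond.add_inNR {x n : ℚ} (hx : DCond p N x) (hn : InNR p N n) : DCond p N (x + n) := by
  obtain ⟨k, j, ε, hε, hX⟩ := hx
  refine ⟨k, j, ε, hε, ?_⟩
  have := hX.add (hn.mul_mem ((ZInv p).pow_mem (by exact_mod_cast intCast_mem_ZInv p p) k))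
  convert this using 1
  ring

end Ring

/-! ## §3 `SL₂(ℤ[1/p])`, `Δ′`, `B⁺`, `B⁻`, the embedding `ι : SL₂(ℤ) → SL₂(ℤ[1/p])` -/

section Groups

variable (p : ℕ) [hp : Fact p.Prime] (N : ℕ)

/-- Entry `(i,j)` of `g ∈ SL₂(ℤ[1/p])` as a rational number. -/
def e (g : SL(2, ZInv p)) (i j : Fin 2) : ℚ := (((g : Matrix (Fin 2) (Fin 2) (ZInv p)) i j : ZInv p) : ℚ)

variable {p}

theorem e_mem (g : SL(2, ZInv p)) (i j : Fin 2) : e p g i j ∈ ZInv p :=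
  ((g : Matrix (Fin 2) (Fin 2) (ZInv p)) i j).2

theorem e_mul (g h : SL(2, ZInv p)) (i j : Fin 2) :
    e p (g * h) i j = e p g i 0 * e p h 0 j + e p g i 1 * e p h 1 j := by
  simp only [e, Matrix.SpecialLinearGroup.coe_mul, Matrix.mul_apply, Fin.sum_univ_two, Subring.coe_add,
    Subring.coe_mul]

theorem e_det (g : SL(2, ZInv p)) : e p g 0 0 * e p g 1 1 - e p g 0 1 * e p g 1 0 = 1 := by
  have h := Matrix.SpecialLinearGroup.det_coe g
  rw [Matrix.det_fin_two] at h
  have h' := congrArg (fun z : ZInv p => (z : ℚ)) h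
  simpa [e] using h'

theorem e_inv (g : SL(2, ZInv p)) :
    e p g⁻¹ 0 0 = e p g 1 1 ∧ e p g⁻¹ 0 1 = -e p g 0 1 ∧ e p g⁻¹ 1 0 = -e p g 1 0 ∧ e p g⁻¹ 1 1 = e p g 0 0 := by
  simp only [e, Matrix.SpecialLinearGroup.coe_inv, Matrix.adjugate_fin_two]
  simp

theorem e_one : e p (1 : SL(2, ZInv p)) 0 0 = 1 ∧ e p (1 : SL(2, ZInv p)) 0 1 = 0 ∧
    e p (1 : SL(2, ZInv p)) 1 0 = 0 ∧ e p (1 : SL(2, ZInv p)) 1 1 = 1 := by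
  simp [e]

variable (p)

/-- `Δ′ = {g ∈ SL₂(ℤ[1/p]) : c ∈ N·ℤ[1/p], d ≡ ±p^ℤ (mod N)}`. -/
def DeltaPrime : Subgroup SL(2, ZInv p) where
  carrier := {g | InNR p N (e p g 1 0) ∧ DCond p N (e p g 1 1)}
  mul_mem' := by
    intro g h hg hh
    refine ⟨?_, ?_⟩
    · rw [e_mul]
      exact (hg.1.mul_mem (e_mem h 0 0)).add (InNR.mem_mul (e_mem g 1 1) hh.1)
    · rw [e_mul, add_comm]
      exact (hg.2.mul hh.2 (e_mem g 1 1) (e_mem h 1 1)).add_inNR (hg.1.mul_mem (e_mem h 0 1))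
  one_mem' := by
    refine ⟨?_, ?_⟩
    · rw [e_one.2.2.1]; exact InNR.zero
    · rw [e_one.2.2.2]; exact DCond.one
  inv_mem' := by
    intro g hg
    refine ⟨?_, ?_⟩
    · rw [(e_inv g).2.2.1]; exact hg.1.neg
    · -- d(g⁻¹) = a(g); a p^j − ε p^k = ε(−a·(d p^k − ε p^j) + (ad − 1) p^k), ad − 1 = bc ∈ N·R
      rw [(e_inv g).2.2.2]
      obtain ⟨k, j, ε, hε, hX⟩ := hg.2
      refine ⟨j, k, ε, hε, ?_⟩
      have hdet := e_det g
      have h1 : InNR p N (-(e p g 0 0) * (e p g 1 1 * (p : ℚ) ^ k - ε * (p : ℚ) ^ j)) :=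
        InNR.mem_mul ((ZInv p).neg_mem (e_mem g 0 0)) hX
      have h2 : InNR p N ((e p g 0 1 * e p g 1 0) * (p : ℚ) ^ k) :=
        (InNR.mem_mul (e_mem g 0 1) hg.1).mul_mem
          ((ZInv p).pow_mem (by exact_mod_cast intCast_mem_ZInv p p) k)
      have h3 := (h1.add h2).mul_mem (by exact_mod_cast intCast_mem_ZInv p ε : (ε : ℚ) ∈ ZInv p)
      have hε2 : (ε : ℚ) * ε = 1 := by rcases hε with rfl | rfl <;> simp
      convert h3 using 1
      linear_combination ((ε : ℚ) * (p : ℚ) ^ k) * hdet + (-(e p g 0 0) * (p : ℚ) ^ j) * hε2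

/-- `B⁺`: upper-triangular elements of `SL₂(ℤ[1/p])`. -/
def Bup : Subgroup SL(2, ZInv p) where
  carrier := {g | e p g 1 0 = 0}
  mul_mem' := by
    intro g h hg hh
    show e p (g * h) 1 0 = 0
    rw [e_mul, hg, hh]; ring
  one_mem' := e_one.2.2.1
  inv_mem' := by intro g hg; show e p g⁻¹ 1 0 = 0; rw [(e_inv g).2.2.1, hg, neg_zero]

/-- `B⁻` (full lower-triangular subgroup of `SL₂(ℤ[1/p])`; intersected with `Δ′` below). -/
def Blo : Subgroup SL(2, ZInv p) where
  carrier := {g | e p g 0 1 = 0}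
  mul_mem' := by
    intro g h hg hh
    show e p (g * h) 0 1 = 0
    rw [e_mul, hg, hh]; ring
  one_mem' := e_one.2.1
  inv_mem' := by intro g hg; show e p g⁻¹ 0 1 = 0; rw [(e_inv g).2.1, hg, neg_zero]

/-- The embedding `ι : SL₂(ℤ) → SL₂(ℤ[1/p])`. -/
noncomputable def iota : SL(2, ℤ) →* SL(2, ZInv p) :=
  Matrix.SpecialLinearGroup.map (Int.castRingHom (ZInv p))

theorem e_iota (γ : SL(2, ℤ)) (i j : Fin 2) : e p (iota p γ) i j = ((γ : Matrix (Fin 2) (Fin 2) ℤ) i j : ℚ) := by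
  simp [e, iota, Matrix.SpecialLinearGroup.map, RingHom.mapMatrix_apply, Matrix.map_apply]

theorem iota_injective : Function.Injective (iota p) := by
  intro γ δ h
  ext i j
  have := congrArg (fun g => e p g i j) h
  simp only [e_iota] at this
  exact_mod_cast this

variable {N}

/-- `ι(γ) ∈ Δ′` for `γ ∈ Γ′`. -/
theorem iota_mem_deltaPrime [NeZero N] {γ : SL(2, ℤ)} (hγ : γ ∈ gammaPrimeSet N p) :
    iota p γ ∈ DeltaPrime p N := by
  obtain ⟨hγ0, k, hk⟩ := hγ
  refine ⟨?_, ?_⟩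
  · rw [e_iota]
    apply InNR.of_dvd
    have hc : (((γ : Matrix (Fin 2) (Fin 2) ℤ) 1 0 : ℤ) : ZMod N) = 0 := Gamma0_mem.mp hγ0
    exact (ZMod.intCast_zmod_eq_zero_iff_dvd _ N).mp hc
  · rw [e_iota]
    -- d ≡ ε p^k (mod N): d·p^0 − ε p^k ∈ Nℤ
    have hcases : ∃ ε : ℤ, (ε = 1 ∨ ε = -1) ∧
        (N : ℤ) ∣ ((γ : Matrix (Fin 2) (Fin 2) ℤ) 1 1 : ℤ) - ε * (p : ℤ) ^ k := by
      rcases hk with h | h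
      · refine ⟨1, Or.inl rfl, ?_⟩
        apply (ZMod.intCast_zmod_eq_zero_iff_dvd _ N).mp
        push_cast; rw [h]; ring
      · refine ⟨-1, Or.inr rfl, ?_⟩
        apply (ZMod.intCast_zmod_eq_zero_iff_dvd _ N).mp
        push_cast; rw [h]; ring
    obtain ⟨ε, hε, hdvd⟩ := hcases
    refine ⟨0, k, ε, hε, ?_⟩
    have := InNR.of_dvd (p := p) hdvd
    convert this using 1
    push_cast; ring

end Groups

/-! ## §4 (VL) as a named Prop, transversality Props, and LEMMA′ -/

section Main

variable (p : ℕ) [hp : Fact p.Prime] (N : ℕ)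

/-- The elementary generators: `U(x) = (1 x; 0 1)`, `x ∈ ℤ[1/p]`, and `V(y) = (1 0; y 1)`, `y ∈ N·ℤ[1/p]`. -/
def elemGens : Set SL(2, ZInv p) :=
  {g | e p g 1 0 = 0 ∧ e p g 0 0 = 1 ∧ e p g 1 1 = 1} ∪
  {g | e p g 0 1 = 0 ∧ e p g 0 0 = 1 ∧ e p g 1 1 = 1 ∧ InNR p N (e p g 1 0)}

/-- **(VL) Vaserstein 1972 / Liehl 1981** for `A = ℤ[1/p]`, `I₁ = A`, `I₂ = N·A`:
`G(A, N·A) = {g : c ∈ N·A, a ≡ d ≡ 1 mod N·A}` is generated by `U(A) ∪ V(N·A)` (the non-trivial inclusion).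
[cite: Vaserstein 1972 (Mat. Sb. 89), Liehl 1981 (J. reine angew. Math. 323); arXiv:1412.0953 Thm 2.1;
arXiv:2404.01449 Thm 4.1]  — a HYPOTHESIS below, never asserted. -/
def VasersteinLiehl : Prop :=
  ∀ g : SL(2, ZInv p), InNR p N (e p g 1 0) → InNR p N (e p g 0 0 - 1) → InNR p N (e p g 1 1 - 1) →
    g ∈ Subgroup.closure (elemGens p N)

/-- **(T⁻)** `Δ′ = ι(Γ′)·B⁻`: every `g ∈ Δ′` is `ι(γ)·b` with `γ ∈ Γ′`, `b` lower triangular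
(memo §1: the reduced denominator of `g·0` is prime to `N` and `≡ ±p^ℤ mod N`). -/
def TransMinus : Prop :=
  ∀ g : SL(2, ZInv p), g ∈ DeltaPrime p N →
    ∃ γ : SL(2, ℤ), γ ∈ gammaPrimeSet N p ∧ e p ((iota p γ)⁻¹ * g) 0 1 = 0

/-- **(T⁺)** `Δ′ = ι(Γ′)·B⁺` (memo §1: reduced fraction of `g·∞`). -/
def TransPlus : Prop :=
  ∀ g : SL(2, ZInv p), g ∈ DeltaPrime p N →
    ∃ γ : SL(2, ℤ), γ ∈ gammaPrimeSet N p ∧ e p ((iota p γ)⁻¹ * g) 1 0 = 0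

variable {p N}

/-- An integer which is a unit of `ℤ[1/p]` is `± p^k`. -/
theorem int_eq_pm_pow_of_mul_eq_one {d : ℤ} {y : ℚ} (hy : y ∈ ZInv p) (h : (d : ℚ) * y = 1) :
    ∃ k : ℕ, d = (p : ℤ) ^ k ∨ d = -((p : ℤ) ^ k) := by
  obtain ⟨n, a, rfl⟩ := hy
  have hpn : (p : ℚ) ^ n ≠ 0 := pow_ne_zero _ (by exact_mod_cast hp.out.ne_zero)
  have hda : d * a = (p : ℤ) ^ n := by
    have : (d : ℚ) * a = (p : ℚ) ^ n := by
      field_simp at h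
      linarith [h]
    exact_mod_cast this
  have hdvd : d.natAbs ∣ p ^ n := by
    have : d ∣ (p : ℤ) ^ n := ⟨a, hda.symm⟩
    rw [← Int.natAbs_dvd_natAbs] at this
    simpa [Int.natAbs_pow] using this
  obtain ⟨k, -, hk⟩ := (Nat.dvd_prime_pow hp.out).mp hdvd
  refine ⟨k, ?_⟩
  rcases Int.natAbs_eq d with h' | h'
  · left; rw [h', hk]; push_cast; ring
  · right; rw [h', hk]; push_cast; ring

/-- **(S)**: an element of `Γ₀(N)` that factors as (upper)·(lower) in `SL₂(ℤ[1/p])` has `d = ±p^k`. -/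
theorem mem_pPowerCuspSet_of_factor {γ : SL(2, ℤ)} (hγ : γ ∈ Gamma0 N) {u v : SL(2, ZInv p)}
    (hu : u ∈ Bup p) (hv : v ∈ Blo p) (h : iota p γ = u * v) : γ ∈ pPowerCuspSet N p := by
  refine ⟨hγ, ?_⟩
  -- d(γ) = u₁₁ v₁₁, and u₁₁, v₁₁ are units of ℤ[1/p]
  have hd : ((γ : Matrix (Fin 2) (Fin 2) ℤ) 1 1 : ℚ) = e p u 1 1 * e p v 1 1 := by
    rw [← e_iota (p := p), h, e_mul]
    have hu0 : e p u 1 0 = 0 := hu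
    rw [hu0]; ring
  have hu1 : e p u 0 0 * e p u 1 1 = 1 := by
    have := e_det u; have hu0 : e p u 1 0 = 0 := hu; rw [hu0] at this; linarith
  have hv1 : e p v 0 0 * e p v 1 1 = 1 := by
    have := e_det v; have hv0 : e p v 0 1 = 0 := hv; rw [hv0] at this; linarith
  have hunit : (((γ : Matrix (Fin 2) (Fin 2) ℤ) 1 1 : ℤ) : ℚ) * (e p u 0 0 * e p v 0 0) = 1 := by
    rw [hd]
    calc e p u 1 1 * e p v 1 1 * (e p u 0 0 * e p v 0 0)
        = (e p u 0 0 * e p u 1 1) * (e p v 0 0 * e p v 1 1) := by ring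
      _ = 1 := by rw [hu1, hv1, one_mul]
  exact int_eq_pm_pow_of_mul_eq_one ((ZInv p).mul_mem (e_mem u 0 0) (e_mem v 0 0)) hunit

/-- Transport of `closure` into the subtype `↥Δ′`. -/
theorem mem_closure_subgroupOf {G : Type*} [Group G] (K : Subgroup G) (T : Set K) {x : G}
    (hx : x ∈ Subgroup.closure ((K.subtype) '' T)) (hxK : x ∈ K) :
    (⟨x, hxK⟩ : K) ∈ Subgroup.closure T := by
  rw [← MonoidHom.map_closure] at hx
  obtain ⟨y, hy, hyx⟩ := Subgroup.mem_map.mp hx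
  have : y = ⟨x, hxK⟩ := Subtype.ext (by simpa using hyx)
  rw [← this]; exact hy

/-- `closure(B⁺ ∪ B⁻) = Δ′` inside `Δ′`, from (VL). -/
theorem closure_eq_top_of_VL (hVL : VasersteinLiehl p N) :
    Subgroup.closure ((((Bup p).subgroupOf (DeltaPrime p N)) : Set (DeltaPrime p N)) ∪
      (((Blo p).subgroupOf (DeltaPrime p N)) : Set (DeltaPrime p N))) = ⊤ := by
  classical
  set K := DeltaPrime p N with hK
  set T : Set K := (((Bup p).subgroupOf K) : Set K) ∪ (((Blo p).subgroupOf K) : Set K) with hT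
  rw [eq_top_iff]
  rintro ⟨g, hg⟩ -
  -- the ambient set K.subtype '' T = {x ∈ Δ′ | x ∈ B⁺ ∨ x ∈ B⁻}
  have hTimg : ∀ x : SL(2, ZInv p), x ∈ K → (x ∈ Bup p ∨ x ∈ Blo p) → x ∈ (K.subtype) '' T := by
    intro x hxK hx
    refine ⟨⟨x, hxK⟩, ?_, rfl⟩
    rcases hx with hx | hx
    · exact Or.inl (Subgroup.mem_subgroupOf.mpr hx)
    · exact Or.inr (Subgroup.mem_subgroupOf.mpr hx)
  -- Step 1: the diagonal correction D = diag(x, x⁻¹), x = ε p^j / p^k, lies in B⁺ ∩ Δ′ (indeed in B⁺ ∩ B⁻)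
  obtain ⟨k, j, ε, hε, hX⟩ := hg.2
  have hp0 : (p : ℚ) ≠ 0 := by exact_mod_cast hp.out.ne_zero
  have hεQ : (ε : ℚ) * ε = 1 := by rcases hε with rfl | rfl <;> simp
  -- build D as an element of SL(2, ZInv p)
  let x : ℚ := (ε : ℚ) * (p : ℚ) ^ j / (p : ℚ) ^ k
  let xi : ℚ := (ε : ℚ) * (p : ℚ) ^ k / (p : ℚ) ^ j
  have hxR : x ∈ ZInv p := ⟨k, ε * (p : ℤ) ^ j, by push_cast; rfl⟩
  have hxiR : xi ∈ ZInv p := ⟨j, ε * (p : ℤ) ^ k, by push_cast; rfl⟩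
  have hpk : (p : ℚ) ^ k ≠ 0 := pow_ne_zero _ hp0
  have hpj : (p : ℚ) ^ j ≠ 0 := pow_ne_zero _ hp0
  have hpj' : (p : ℚ) ^ j * ((p : ℚ) ^ j)⁻¹ = 1 := mul_inv_cancel₀ hpj
  have hpk' : (p : ℚ) ^ k * ((p : ℚ) ^ k)⁻¹ = 1 := mul_inv_cancel₀ hpk
  have hxxi : x * xi = 1 := by
    simp only [x, xi, div_eq_mul_inv]
    linear_combination ((p : ℚ) ^ j * ((p : ℚ) ^ j)⁻¹ * ((p : ℚ) ^ k * ((p : ℚ) ^ k)⁻¹)) * hεQ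
      + ((p : ℚ) ^ k * ((p : ℚ) ^ k)⁻¹) * hpj' + hpk'
  let Dm : Matrix (Fin 2) (Fin 2) (ZInv p) := !![⟨x, hxR⟩, 0; 0, ⟨xi, hxiR⟩]
  have hDdet : Dm.det = 1 := by
    rw [Matrix.det_fin_two_of]
    apply Subtype.ext
    show x * xi - 0 * 0 = (1 : ℚ)
    rw [hxxi]; ring
  let D : SL(2, ZInv p) := ⟨Dm, hDdet⟩
  have hD00 : e p D 0 0 = x := rfl
  have hD01 : e p D 0 1 = 0 := rfl
  have hD10 : e p D 1 0 = 0 := rfl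
  have hD11 : e p D 1 1 = xi := rfl
  have hDK : D ∈ K := by
    refine ⟨by rw [hD10]; exact InNR.zero, ?_⟩
    refine ⟨j, k, ε, hε, ?_⟩
    rw [hD11]
    have : xi * (p : ℚ) ^ j - ε * (p : ℚ) ^ k = 0 := by
      simp only [xi]; rw [div_mul_cancel₀ _ hpj]; ring
    rw [this]; exact InNR.zero
  have hDup : D ∈ Bup p := hD10
  -- Step 2: g₁ := D * g lies in G(A, N·A)
  have hg1c : InNR p N (e p (D * g) 1 0) := by
    rw [e_mul, hD10, hD11, zero_mul, zero_add]; exact InNR.mem_mul hxiR hg.1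
  have hg1d : InNR p N (e p (D * g) 1 1 - 1) := by
    rw [e_mul, hD10, hD11, zero_mul, zero_add]
    -- xi·d − 1 = (ε p^k/p^j)·d − 1 = ε/p^j · (d p^k − ε p^j)
    have := hX.mul_mem ((ZInv p).mul_mem (by exact_mod_cast intCast_mem_ZInv p ε : (ε : ℚ) ∈ ZInv p)
      (pow_inv_mem_ZInv p j))
    convert this using 1
    simp only [xi, div_eq_mul_inv]
    linear_combination hεQ + ((ε : ℚ) * ε) * hpj'
  have hg1a : InNR p N (e p (D * g) 0 0 - 1) := by
    -- a₁ − 1 = (a₁ d₁ − 1) − a₁ (d₁ − 1) = b₁ c₁ − a₁ (d₁ − 1)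
    have hdet := e_det (D * g)
    have h1 : InNR p N (e p (D * g) 0 1 * e p (D * g) 1 0) := InNR.mem_mul (e_mem _ 0 1) hg1c
    have h2 : InNR p N (e p (D * g) 0 0 * (e p (D * g) 1 1 - 1)) := InNR.mem_mul (e_mem _ 0 0) hg1d
    have := h1.sub h2
    convert this using 1
    linarith
  have hg1 : D * g ∈ Subgroup.closure (elemGens p N) := hVL (D * g) hg1c hg1a hg1d
  -- Step 3: elemGens ⊆ K.subtype '' T, and D ∈ K.subtype '' T
  have hsub : elemGens p N ⊆ (K.subtype) '' T := by
    intro y hy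
    rcases hy with ⟨hy10, hy00, hy11⟩ | ⟨hy01, hy00, hy11, hyc⟩
    · refine hTimg y ⟨by rw [hy10]; exact InNR.zero, by rw [hy11]; exact DCond.one⟩ (Or.inl hy10)
    · refine hTimg y ⟨hyc, by rw [hy11]; exact DCond.one⟩ (Or.inr hy01)
  have hg1' : D * g ∈ Subgroup.closure ((K.subtype) '' T) := Subgroup.closure_mono hsub hg1
  have hDT : D ∈ Subgroup.closure ((K.subtype) '' T) := Subgroup.subset_closure (hTimg D hDK (Or.inl hDup))
  have hgT : g ∈ Subgroup.closure ((K.subtype) '' T) := by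
    have := (Subgroup.closure ((K.subtype) '' T)).mul_mem ((Subgroup.closure _).inv_mem hDT) hg1'
    rwa [← mul_assoc, inv_mul_cancel, one_mul] at this
  exact mem_closure_subgroupOf K T hgT hg

/-- **LEMMA′ from (VL) + (T⁻) + (T⁺)** via the coset lemma. -/
theorem lemmaPrimeHom_of_VL [NeZero N] (hVL : VasersteinLiehl p N) (hTm : TransMinus p N)
    (hTp : TransPlus p N) : LemmaPrimeHom N p := by
  classical
  intro A _ ψ hψ γ hγ
  set K := DeltaPrime p N with hK
  let Bp : Subgroup K := (Bup p).subgroupOf K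
  let Bm : Subgroup K := (Blo p).subgroupOf K
  -- Γ := ι(Γ′) ∩ Δ′ as a subgroup of K: we use the image of the SUBGROUP generated by Γ′ inside SL₂(ℤ);
  -- to stay elementary we take GamZ := closure (gammaPrimeSet N p) and Γ := (GamZ.map ι).subgroupOf K.
  let GamZ : Subgroup SL(2, ℤ) := Subgroup.closure (gammaPrimeSet N p)
  let Γ : Subgroup K := (GamZ.map (iota p)).subgroupOf K
  -- Γ′ is itself a subgroup of SL₂(ℤ): closure adds nothing we need, because every element of the closure
  -- that we evaluate ψ on comes with a witness in Γ₀(N) (closure induction below).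
  -- (1) hgen
  have hgen : Subgroup.closure ((Bp : Set K) ∪ (Bm : Set K)) = ⊤ := closure_eq_top_of_VL hVL
  -- (2) hTm / hTp in the subtype
  have hTm' : ∀ g : K, ∃ γ' ∈ Γ, ∃ b ∈ Bm, g = γ' * b := by
    rintro ⟨g, hg⟩
    obtain ⟨γ₀, hγ₀, hb⟩ := hTm g hg
    have hιK : iota p γ₀ ∈ K := iota_mem_deltaPrime p hγ₀
    refine ⟨⟨iota p γ₀, hιK⟩, ?_, ⟨(iota p γ₀)⁻¹ * g, K.mul_mem (K.inv_mem hιK) hg⟩, ?_, ?_⟩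
    · exact Subgroup.mem_subgroupOf.mpr (Subgroup.mem_map.mpr ⟨γ₀, Subgroup.subset_closure hγ₀, rfl⟩)
    · exact Subgroup.mem_subgroupOf.mpr hb
    · apply Subtype.ext; simp
  have hTp' : ∀ g : K, ∃ γ' ∈ Γ, ∃ b ∈ Bp, g = γ' * b := by
    rintro ⟨g, hg⟩
    obtain ⟨γ₀, hγ₀, hb⟩ := hTp g hg
    have hιK : iota p γ₀ ∈ K := iota_mem_deltaPrime p hγ₀
    refine ⟨⟨iota p γ₀, hιK⟩, ?_, ⟨(iota p γ₀)⁻¹ * g, K.mul_mem (K.inv_mem hιK) hg⟩, ?_, ?_⟩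
    · exact Subgroup.mem_subgroupOf.mpr (Subgroup.mem_map.mpr ⟨γ₀, Subgroup.subset_closure hγ₀, rfl⟩)
    · exact Subgroup.mem_subgroupOf.mpr hb
    · apply Subtype.ext; simp
  -- (3) hstab: Γ ∩ B⁻ ⊆ S (take u = 1)
  have hstab : Γ ⊓ Bm ≤ Subgroup.closure (bigCellSet Bp Bm Γ) := by
    intro x hx
    apply Subgroup.subset_closure
    exact ⟨hx.1, 1, Bp.one_mem, x, hx.2, by rw [one_mul]⟩
  -- (4) the coset lemma
  have hEq : Γ = Subgroup.closure (bigCellSet Bp Bm Γ) := eq_closure_bigCellSet Bp Bm Γ hgen hTm' hTp' hstab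
  -- (5) every element of Γ₀(N) in Γ₀(N) ∩ GamZ ... we show: ∀ x ∈ closure S, ∀ δ ∈ Γ₀(N), ι δ = x → ψ δ = 1,
  --     via the predicate P x := ∃ δ : Gamma0 N, ι δ = x ∧ ψ δ = 1, and injectivity of ι.
  have hP : ∀ x : K, x ∈ Subgroup.closure (bigCellSet Bp Bm Γ) →
      ∃ δ : Gamma0 N, iota p (δ : SL(2, ℤ)) = (x : SL(2, ZInv p)) ∧ ψ δ = 1 := by
    intro x hx
    induction hx using Subgroup.closure_induction with
    | mem y hy =>
        obtain ⟨hyΓ, u, hu, v, hv, hyuv⟩ := hy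
        -- y ∈ Γ: y = ι δ₀ with δ₀ ∈ GamZ; but we need δ₀ ∈ Γ₀(N) with d = ±p^k. Every element of GamZ is in
        -- Γ₀(N) (closure of a subset of the subgroup Γ₀(N)).
        obtain ⟨δ₀, hδ₀, hδ₀y⟩ := Subgroup.mem_map.mp (Subgroup.mem_subgroupOf.mp hyΓ)
        have hδ₀Γ0 : δ₀ ∈ Gamma0 N := by
          have : GamZ ≤ Gamma0 N := (Subgroup.closure_le _).mpr (fun z hz => hz.1)
          exact this hδ₀
        have hfac : iota p δ₀ = (u : SL(2, ZInv p)) * (v : SL(2, ZInv p)) := by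
          rw [hδ₀y, hyuv]; rfl
        have hS : δ₀ ∈ pPowerCuspSet N p :=
          mem_pPowerCuspSet_of_factor hδ₀Γ0 (Subgroup.mem_subgroupOf.mp hu) (Subgroup.mem_subgroupOf.mp hv) hfac
        exact ⟨⟨δ₀, hδ₀Γ0⟩, hδ₀y, hψ ⟨δ₀, hδ₀Γ0⟩ hS⟩
    | one => exact ⟨1, by simp, map_one ψ⟩
    | mul y z hy hz ihy ihz =>
        obtain ⟨δ₁, h₁, hψ₁⟩ := ihy
        obtain ⟨δ₂, h₂, hψ₂⟩ := ihz
        refine ⟨δ₁ * δ₂, ?_, by rw [map_mul, hψ₁, hψ₂, one_mul]⟩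
        rw [Subgroup.coe_mul, map_mul, h₁, h₂]; rfl
    | inv y hy ihy =>
        obtain ⟨δ₁, h₁, hψ₁⟩ := ihy
        refine ⟨δ₁⁻¹, ?_, by rw [map_inv, hψ₁, inv_one]⟩
        rw [Subgroup.coe_inv, map_inv, h₁]; rfl
  -- (6) conclude for γ
  have hγK : iota p (γ : SL(2, ℤ)) ∈ K := iota_mem_deltaPrime p hγ
  have hγΓ : (⟨iota p (γ : SL(2, ℤ)), hγK⟩ : K) ∈ Γ :=
    Subgroup.mem_subgroupOf.mpr (Subgroup.mem_map.mpr ⟨γ, Subgroup.subset_closure hγ, rfl⟩)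
  rw [hEq] at hγΓ
  obtain ⟨δ, hδ, hψδ⟩ := hP _ hγΓ
  have : δ = γ := by
    apply Subtype.ext
    exact iota_injective p hδ
  rw [← this]; exact hψδ

end Main

/-! ## §5 Transversality (T⁻), (T⁺): elementary number theory (memo §1), now PROVED -/

section Trans

variable {p : ℕ} [hp : Fact p.Prime] {N : ℕ}

/-- `DCond` also holds for the upper-left entry of an element of `Δ′`. -/
theorem dcond_fst {g : SL(2, ZInv p)} (hg : g ∈ DeltaPrime p N) : DCond p N (e p g 0 0) := by
  have h := ((DeltaPrime p N).inv_mem hg).2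
  rwa [(e_inv g).2.2.2] at h

/-- Common `p`-power denominator for the four entries. -/
theorem exists_common_denom (g : SL(2, ZInv p)) :
    ∃ (M : ℕ) (A B C D : ℤ), e p g 0 0 = A / (p : ℚ) ^ M ∧ e p g 0 1 = B / (p : ℚ) ^ M ∧
      e p g 1 0 = C / (p : ℚ) ^ M ∧ e p g 1 1 = D / (p : ℚ) ^ M := by
  have hp0 : (p : ℚ) ≠ 0 := by exact_mod_cast hp.out.ne_zero
  have resc : ∀ (x : ℚ) (n : ℕ) (a : ℤ), x = a / (p : ℚ) ^ n → ∀ m : ℕ,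
      x = ((a * (p : ℤ) ^ m : ℤ) : ℚ) / (p : ℚ) ^ (n + m) := by
    intro x n a hx m
    rw [hx, pow_add]; push_cast
    rw [mul_div_mul_right _ _ (pow_ne_zero m hp0)]
  obtain ⟨n₁, a₁, h₁⟩ := (mem_ZInv_iff p _).mp (e_mem g 0 0)
  obtain ⟨n₂, a₂, h₂⟩ := (mem_ZInv_iff p _).mp (e_mem g 0 1)
  obtain ⟨n₃, a₃, h₃⟩ := (mem_ZInv_iff p _).mp (e_mem g 1 0)
  obtain ⟨n₄, a₄, h₄⟩ := (mem_ZInv_iff p _).mp (e_mem g 1 1)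
  refine ⟨n₁ + n₂ + n₃ + n₄, a₁ * (p : ℤ) ^ (n₂ + n₃ + n₄), a₂ * (p : ℤ) ^ (n₁ + n₃ + n₄),
    a₃ * (p : ℤ) ^ (n₁ + n₂ + n₄), a₄ * (p : ℤ) ^ (n₁ + n₂ + n₃), ?_, ?_, ?_, ?_⟩
  · rw [show n₁ + n₂ + n₃ + n₄ = n₁ + (n₂ + n₃ + n₄) by ring]; exact resc _ _ _ h₁ _
  · rw [show n₁ + n₂ + n₃ + n₄ = n₂ + (n₁ + n₃ + n₄) by ring]; exact resc _ _ _ h₂ _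
  · rw [show n₁ + n₂ + n₃ + n₄ = n₃ + (n₁ + n₂ + n₄) by ring]; exact resc _ _ _ h₃ _
  · rw [show n₁ + n₂ + n₃ + n₄ = n₄ + (n₁ + n₂ + n₃) by ring]; exact resc _ _ _ h₄ _

/-- Integral determinant `A D − B C = p^{2M}`. -/
theorem det_int {g : SL(2, ZInv p)} {M : ℕ} {A B C D : ℤ} (ha : e p g 0 0 = A / (p : ℚ) ^ M)
    (hb : e p g 0 1 = B / (p : ℚ) ^ M) (hc : e p g 1 0 = C / (p : ℚ) ^ M)
    (hd : e p g 1 1 = D / (p : ℚ) ^ M) : A * D - B * C = (p : ℤ) ^ (2 * M) := by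
  have hp0 : (p : ℚ) ≠ 0 := by exact_mod_cast hp.out.ne_zero
  have hPM : (p : ℚ) ^ M * ((p : ℚ) ^ M)⁻¹ = 1 := mul_inv_cancel₀ (pow_ne_zero M hp0)
  have hdet := e_det g
  rw [ha, hb, hc, hd] at hdet
  simp only [div_eq_mul_inv] at hdet
  have hQ : (A : ℚ) * D - B * C = (p : ℚ) ^ (2 * M) := by
    rw [pow_mul', sq]
    linear_combination ((p : ℚ) ^ M * (p : ℚ) ^ M) * hdet
      - ((A : ℚ) * D - B * C) * (((p : ℚ) ^ M)⁻¹ * (p : ℚ) ^ M + 1) * hPM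
  exact_mod_cast hQ

/-- The gcd of two of the integral numerators divides `p^{2M}`, hence is a power of `p`. -/
theorem gcd_eq_prime_pow {X Y : ℤ} {M : ℕ} (h : (Int.gcd X Y : ℤ) ∣ (p : ℤ) ^ (2 * M)) :
    ∃ i : ℕ, Int.gcd X Y = p ^ i := by
  have h' : Int.gcd X Y ∣ p ^ (2 * M) := by
    have : ((Int.gcd X Y : ℕ) : ℤ) ∣ ((p ^ (2 * M) : ℕ) : ℤ) := by push_cast; exact h
    exact Int.natCast_dvd_natCast.mp this
  obtain ⟨i, -, hi⟩ := (Nat.dvd_prime_pow hp.out).mp h'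
  exact ⟨i, hi⟩

/-- `(p : ZMod N)^e` has an inverse which is again a power of `p`. -/
theorem exists_pow_mul_pow_eq_one [NeZero N] (hpN : Nat.Coprime p N) (e₀ : ℕ) :
    ∃ e' : ℕ, (p : ZMod N) ^ e₀ * (p : ZMod N) ^ e' = 1 := by
  have hφ : 0 < Nat.totient N := Nat.totient_pos.mpr (NeZero.pos N)
  obtain ⟨m, hm⟩ : ∃ m : ℕ, Nat.totient N = m + 1 := ⟨Nat.totient N - 1, by omega⟩
  refine ⟨e₀ * m, ?_⟩
  have hu : (p : ZMod N) ^ Nat.totient N = 1 := by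
    have h1 := ZMod.pow_totient (ZMod.unitOfCoprime p hpN)
    rw [Units.ext_iff, Units.val_pow_eq_pow_val, ZMod.coe_unitOfCoprime, Units.val_one] at h1
    exact h1
  rw [← pow_add, show e₀ + e₀ * m = Nat.totient N * e₀ by rw [hm]; ring, pow_mul, hu, one_pow]

/-- From `v · p^{e₂} = ε · p^{e₁}` in `ZMod N` (`ε = ±1`): `v ≡ ± p^K`. -/
theorem zmod_eq_pm_pow [NeZero N] (hpN : Nat.Coprime p N) {v ε : ℤ} (hε : ε = 1 ∨ ε = -1)
    {e₁ e₂ : ℕ} (h : (v : ZMod N) * (p : ZMod N) ^ e₂ = (ε : ZMod N) * (p : ZMod N) ^ e₁) :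
    ∃ K : ℕ, (v : ZMod N) = (p : ZMod N) ^ K ∨ (v : ZMod N) = -((p : ZMod N) ^ K) := by
  obtain ⟨e', he'⟩ := exists_pow_mul_pow_eq_one hpN e₂
  refine ⟨e₁ + e', ?_⟩
  have hv : (v : ZMod N) = (ε : ZMod N) * (p : ZMod N) ^ (e₁ + e') := by
    calc (v : ZMod N) = (v : ZMod N) * ((p : ZMod N) ^ e₂ * (p : ZMod N) ^ e') := by
            rw [he', mul_one]
      _ = ((v : ZMod N) * (p : ZMod N) ^ e₂) * (p : ZMod N) ^ e' := by ring
      _ = (ε : ZMod N) * (p : ZMod N) ^ (e₁ + e') := by rw [h, pow_add]; ring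
  rcases hε with rfl | rfl
  · left; rw [hv]; push_cast; ring
  · right; rw [hv]; push_cast; ring

theorem isUnit_zmod_of_eq_pm_pow (hpN : Nat.Coprime p N) {v : ℤ} {K : ℕ}
    (h : (v : ZMod N) = (p : ZMod N) ^ K ∨ (v : ZMod N) = -((p : ZMod N) ^ K)) :
    IsUnit (v : ZMod N) := by
  have hu : IsUnit ((p : ZMod N) ^ K) := by
    have : IsUnit (p : ZMod N) := by
      rw [← ZMod.coe_unitOfCoprime p hpN]; exact Units.isUnit _
    exact this.pow K
  rcases h with h | h
  · rw [h]; exact hu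
  · rw [h]; exact hu.neg

/-- Clearing denominators: from `X/p^M · p^k − ε·p^j ∈ N·ℤ[1/p]`,
`X · p^{k+n'} = ε · p^{j+M+n'}` in `ZMod N` for some `n'`. -/
theorem zmod_congr_of_inNR {X : ℤ} {M k j : ℕ} {ε : ℤ}
    (h : InNR p N ((X : ℚ) / (p : ℚ) ^ M * (p : ℚ) ^ k - ε * (p : ℚ) ^ j)) :
    ∃ n' : ℕ, (X : ZMod N) * (p : ZMod N) ^ (k + n') = (ε : ZMod N) * (p : ZMod N) ^ (j + M + n') := by
  obtain ⟨n', t', hX⟩ := h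
  refine ⟨n', ?_⟩
  have hp0 : (p : ℚ) ≠ 0 := by exact_mod_cast hp.out.ne_zero
  have hPM : (p : ℚ) ^ M * ((p : ℚ) ^ M)⁻¹ = 1 := mul_inv_cancel₀ (pow_ne_zero M hp0)
  have hPn : (p : ℚ) ^ n' * ((p : ℚ) ^ n')⁻¹ = 1 := mul_inv_cancel₀ (pow_ne_zero n' hp0)
  have hQ : (X : ℚ) * (p : ℚ) ^ k * (p : ℚ) ^ n' - (ε : ℚ) * (p : ℚ) ^ j * (p : ℚ) ^ M * (p : ℚ) ^ n'
      = (N : ℚ) * t' * (p : ℚ) ^ M := by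
    simp only [div_eq_mul_inv] at hX
    linear_combination ((p : ℚ) ^ M * (p : ℚ) ^ n') * hX
      - ((X : ℚ) * (p : ℚ) ^ k * (p : ℚ) ^ n') * hPM + ((N : ℚ) * t' * (p : ℚ) ^ M) * hPn
  have hZ : X * (p : ℤ) ^ k * (p : ℤ) ^ n' - ε * (p : ℤ) ^ j * (p : ℤ) ^ M * (p : ℤ) ^ n'
      = (N : ℤ) * t' * (p : ℤ) ^ M := by
    exact_mod_cast hQ
  have hmod := congrArg (fun z : ℤ => (z : ZMod N)) hZ
  push_cast at hmod
  simp only [ZMod.natCast_self, zero_mul] at hmod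
  rw [pow_add, show j + M + n' = j + (M + n') by ring, pow_add, pow_add]
  linear_combination hmod

/-- An `SL₂(ℤ)` element with prescribed coprime first column. -/
theorem exists_SL2_col (u v : ℤ) (h : IsCoprime u v) :
    ∃ γ : SL(2, ℤ), (γ : Matrix (Fin 2) (Fin 2) ℤ) 0 0 = u ∧ (γ : Matrix (Fin 2) (Fin 2) ℤ) 1 0 = v := by
  obtain ⟨x, y, hxy⟩ := h
  exact ⟨⟨!![u, -y; v, x], by rw [Matrix.det_fin_two_of]; linear_combination hxy⟩, rfl, rfl⟩

/-- A `Γ₀(N)` element with prescribed second column `(s, t)`, `t` coprime to `sN`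
(as `EGSymbolStep_g9.exists_gamma0_entries`). -/
theorem exists_gamma0_entries (s t : ℤ) (h : IsCoprime t (s * N)) :
    ∃ γ : SL(2, ℤ), γ ∈ Gamma0 N ∧ (γ : Matrix (Fin 2) (Fin 2) ℤ) 0 1 = s ∧
      (γ : Matrix (Fin 2) (Fin 2) ℤ) 1 1 = t := by
  obtain ⟨u, w, huw⟩ := h
  refine ⟨⟨!![u, s; -(w * N), t], by rw [Matrix.det_fin_two_of]; linear_combination huw⟩, ?_, rfl, rfl⟩
  rw [Gamma0_mem]
  show (((-(w * (N : ℤ))) : ℤ) : ZMod N) = 0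
  push_cast
  simp

theorem e_iota_inv_mul_01 (γ : SL(2, ℤ)) (g : SL(2, ZInv p)) :
    e p ((iota p γ)⁻¹ * g) 0 1 = ((γ : Matrix (Fin 2) (Fin 2) ℤ) 1 1 : ℚ) * e p g 0 1
      - ((γ : Matrix (Fin 2) (Fin 2) ℤ) 0 1 : ℚ) * e p g 1 1 := by
  rw [e_mul, (e_inv _).1, (e_inv _).2.1, e_iota, e_iota]; ring

theorem e_iota_inv_mul_10 (γ : SL(2, ℤ)) (g : SL(2, ZInv p)) :
    e p ((iota p γ)⁻¹ * g) 1 0 = -((γ : Matrix (Fin 2) (Fin 2) ℤ) 1 0 : ℚ) * e p g 0 0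
      + ((γ : Matrix (Fin 2) (Fin 2) ℤ) 0 0 : ℚ) * e p g 1 0 := by
  rw [e_mul, (e_inv _).2.2.1, (e_inv _).2.2.2, e_iota, e_iota]

/-- **(T⁻)** proved: `Δ′ = ι(Γ′)·B⁻`. -/
theorem transMinus_holds [NeZero N] (hpN : Nat.Coprime p N) : TransMinus p N := by
  intro g hg
  have hpz : (p : ℤ) ≠ 0 := by exact_mod_cast hp.out.ne_zero
  obtain ⟨M, A, B, C, D, ha, hb, hc, hd⟩ := exists_common_denom g
  have hdet := det_int ha hb hc hd
  -- g₀ := gcd(B, D) > 0 and a power of p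
  have hg0 : 0 < Int.gcd B D := by
    rw [Int.gcd_pos_iff]
    by_contra h0
    simp only [not_or, not_ne_iff] at h0
    have : (p : ℤ) ^ (2 * M) = 0 := by rw [← hdet, h0.1, h0.2]; ring
    exact pow_ne_zero _ hpz this
  have hdvd : (Int.gcd B D : ℤ) ∣ (p : ℤ) ^ (2 * M) := by
    rw [← hdet]
    exact dvd_sub (dvd_mul_of_dvd_right (Int.gcd_dvd_right ..) _)
      (dvd_mul_of_dvd_left (Int.gcd_dvd_left ..) _)
  obtain ⟨i, hi⟩ := gcd_eq_prime_pow hdvd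
  obtain ⟨u, v, huv, hBu, hDv⟩ := Int.exists_gcd_one hg0
  have hgi : ((Int.gcd B D : ℕ) : ℤ) = (p : ℤ) ^ i := by rw [hi]; push_cast; rfl
  rw [hgi] at hBu hDv
  -- the congruence for D from DCond(d)
  have hg' : InNR p N (e p g 1 0) ∧ DCond p N (e p g 1 1) := hg
  obtain ⟨-, k, j, ε, hε, hX⟩ := hg'
  rw [hd] at hX
  obtain ⟨n', hmod⟩ := zmod_congr_of_inNR hX
  -- v · p^{i+k+n'} = ε · p^{j+M+n'}
  have hv : (v : ZMod N) * (p : ZMod N) ^ (i + (k + n')) = (ε : ZMod N) * (p : ZMod N) ^ (j + M + n') := by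
    rw [← hmod, hDv]; push_cast; ring
  obtain ⟨K, hK⟩ := zmod_eq_pm_pow hpN hε hv
  -- coprimality and the Γ₀(N) element with second column (u, v)
  have hvN : IsCoprime v (N : ℤ) :=
    ((ZMod.coe_int_isUnit_iff_isCoprime v N).mp (isUnit_zmod_of_eq_pm_pow hpN hK)).symm
  have hvu : IsCoprime v u := (Int.isCoprime_iff_gcd_eq_one.mpr huv).symm
  obtain ⟨γ, hγ0, hγ01, hγ11⟩ := exists_gamma0_entries (N := N) u v (hvu.mul_right hvN)
  refine ⟨γ, ⟨hγ0, K, ?_⟩, ?_⟩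
  · rw [hγ11]; exact hK
  · rw [e_iota_inv_mul_01, hγ01, hγ11, hb, hd, hBu, hDv]
    push_cast; ring

/-- **(T⁺)** proved: `Δ′ = ι(Γ′)·B⁺`. -/
theorem transPlus_holds [NeZero N] (hpN : Nat.Coprime p N) : TransPlus p N := by
  intro g hg
  have hpz : (p : ℤ) ≠ 0 := by exact_mod_cast hp.out.ne_zero
  obtain ⟨M, A, B, C, D, ha, hb, hc, hd⟩ := exists_common_denom g
  have hdet := det_int ha hb hc hd
  -- g₀ := gcd(A, C) > 0 and a power of p
  have hg0 : 0 < Int.gcd A C := by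
    rw [Int.gcd_pos_iff]
    by_contra h0
    simp only [not_or, not_ne_iff] at h0
    have : (p : ℤ) ^ (2 * M) = 0 := by rw [← hdet, h0.1, h0.2]; ring
    exact pow_ne_zero _ hpz this
  have hdvd : (Int.gcd A C : ℤ) ∣ (p : ℤ) ^ (2 * M) := by
    rw [← hdet]
    exact dvd_sub (dvd_mul_of_dvd_left (Int.gcd_dvd_left ..) _)
      (dvd_mul_of_dvd_right (Int.gcd_dvd_right ..) _)
  obtain ⟨i, hi⟩ := gcd_eq_prime_pow hdvd
  obtain ⟨u, v, huv, hAu, hCv⟩ := Int.exists_gcd_one hg0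
  have hgi : ((Int.gcd A C : ℕ) : ℤ) = (p : ℤ) ^ i := by rw [hi]; push_cast; rfl
  rw [hgi] at hAu hCv
  have hg' : InNR p N (e p g 1 0) ∧ DCond p N (e p g 1 1) := hg
  -- N ∣ v : from c ∈ N·ℤ[1/p]
  have hvN : (v : ZMod N) = 0 := by
    obtain ⟨n, t, hct⟩ := hg'.1
    -- C · p^n ≡ 0: reuse `zmod_congr_of_inNR` with k = 0? Direct computation instead:
    have hp0 : (p : ℚ) ≠ 0 := by exact_mod_cast hp.out.ne_zero
    have hPM : (p : ℚ) ^ M * ((p : ℚ) ^ M)⁻¹ = 1 := mul_inv_cancel₀ (pow_ne_zero M hp0)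
    have hPn : (p : ℚ) ^ n * ((p : ℚ) ^ n)⁻¹ = 1 := mul_inv_cancel₀ (pow_ne_zero n hp0)
    rw [hc] at hct
    have hQ : (C : ℚ) * (p : ℚ) ^ n = (N : ℚ) * t * (p : ℚ) ^ M := by
      simp only [div_eq_mul_inv] at hct
      linear_combination ((p : ℚ) ^ M * (p : ℚ) ^ n) * hct - ((C : ℚ) * (p : ℚ) ^ n) * hPM
        + ((N : ℚ) * t * (p : ℚ) ^ M) * hPn
    have hZ : C * (p : ℤ) ^ n = (N : ℤ) * t * (p : ℤ) ^ M := by exact_mod_cast hQ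
    have hmod := congrArg (fun z : ℤ => (z : ZMod N)) hZ
    push_cast at hmod
    simp only [ZMod.natCast_self, zero_mul] at hmod
    rw [hCv] at hmod
    push_cast at hmod
    -- hmod : v * p^i * p^n = 0 ; p is a unit
    have hu : IsUnit ((p : ZMod N) ^ i * (p : ZMod N) ^ n) := by
      have : IsUnit (p : ZMod N) := by
        rw [← ZMod.coe_unitOfCoprime p hpN]; exact Units.isUnit _
      exact (this.pow i).mul (this.pow n)
    have h2 : (v : ZMod N) * ((p : ZMod N) ^ i * (p : ZMod N) ^ n) = 0 := by
      rw [← mul_assoc]; exact hmod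
    exact (IsUnit.mul_left_eq_zero hu).mp h2
  -- u ≡ ± p^K from DCond(a)
  obtain ⟨k, j, ε, hε, hX⟩ := dcond_fst hg
  rw [ha] at hX
  obtain ⟨n', hmodA⟩ := zmod_congr_of_inNR hX
  have hu' : (u : ZMod N) * (p : ZMod N) ^ (i + (k + n')) = (ε : ZMod N) * (p : ZMod N) ^ (j + M + n') := by
    rw [← hmodA, hAu]; push_cast; ring
  obtain ⟨K, hK⟩ := zmod_eq_pm_pow hpN hε hu'
  -- the SL₂(ℤ) element with first column (u, v); it lies in Γ₀(N) since N ∣ v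
  have huv' : IsCoprime u v := Int.isCoprime_iff_gcd_eq_one.mpr huv
  obtain ⟨γ, hγ00, hγ10⟩ := exists_SL2_col u v huv'
  have hγ0 : γ ∈ Gamma0 N := by rw [Gamma0_mem, hγ10]; exact hvN
  -- its lower-right entry: u · γ₁₁ ≡ 1, so γ₁₁ ≡ ± p^{K'}
  have hdetγ : (γ : Matrix (Fin 2) (Fin 2) ℤ) 0 0 * (γ : Matrix (Fin 2) (Fin 2) ℤ) 1 1
      - (γ : Matrix (Fin 2) (Fin 2) ℤ) 0 1 * (γ : Matrix (Fin 2) (Fin 2) ℤ) 1 0 = 1 := by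
    have := Matrix.SpecialLinearGroup.det_coe γ
    rwa [Matrix.det_fin_two] at this
  have h11 : ((γ : Matrix (Fin 2) (Fin 2) ℤ) 1 1 : ZMod N) * (u : ZMod N) = 1 := by
    have hm := congrArg (fun z : ℤ => (z : ZMod N)) hdetγ
    push_cast at hm
    rw [hγ00, hγ10, hvN, mul_zero, sub_zero] at hm
    rw [mul_comm]; exact hm
  have hεε : (ε : ZMod N) * (ε : ZMod N) = 1 := by rcases hε with rfl | rfl <;> push_cast <;> ring
  have hK' : ∃ ε' : ℤ, (ε' = 1 ∨ ε' = -1) ∧ (u : ZMod N) = (ε' : ZMod N) * (p : ZMod N) ^ K := by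
    rcases hK with h | h
    · exact ⟨1, Or.inl rfl, by rw [h]; push_cast; ring⟩
    · exact ⟨-1, Or.inr rfl, by rw [h]; push_cast; ring⟩
  obtain ⟨ε', hε', huε⟩ := hK'
  have hε'2 : (ε' : ZMod N) * (ε' : ZMod N) = 1 := by rcases hε' with rfl | rfl <;> push_cast <;> ring
  have h11' : ((γ : Matrix (Fin 2) (Fin 2) ℤ) 1 1 : ZMod N) * (p : ZMod N) ^ K
      = (ε' : ZMod N) * (p : ZMod N) ^ 0 := by
    rw [pow_zero, mul_one]
    calc ((γ : Matrix (Fin 2) (Fin 2) ℤ) 1 1 : ZMod N) * (p : ZMod N) ^ K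
        = ((γ : Matrix (Fin 2) (Fin 2) ℤ) 1 1 : ZMod N) * ((ε' : ZMod N) * (p : ZMod N) ^ K) * ε' := by
          linear_combination (-((((γ : Matrix (Fin 2) (Fin 2) ℤ) 1 1 : ℤ) : ZMod N) * (p : ZMod N) ^ K)) * hε'2
      _ = ε' := by rw [← huε, h11, one_mul]
  obtain ⟨K', hK'⟩ := zmod_eq_pm_pow hpN hε' h11'
  refine ⟨γ, ⟨hγ0, K', hK'⟩, ?_⟩
  rw [e_iota_inv_mul_10, hγ00, hγ10, ha, hc, hAu, hCv]
  push_cast; ring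

/-- **LEMMA′(N,p) from Vaserstein–Liehl alone** (memo EG-REFEREE-g9 §1), `p ∤ N`, `N ≥ 1`. -/
theorem lemmaPrimeHom_of_vasersteinLiehl [NeZero N] (hpN : Nat.Coprime p N)
    (hVL : VasersteinLiehl p N) : LemmaPrimeHom N p :=
  lemmaPrimeHom_of_VL hVL (transMinus_holds hpN) (transPlus_holds hpN)

end Trans

/-- The content of LEAD's single missing stub `stub_lemmaPrimeHom_three : ∀ N, ¬ 3 ∣ N → LemmaPrimeHom N 3`
(birth_acns v6 + `EGSymbolStep_g9.stub_muOneSign_ns_three_of_lemmaPrimeHom`), reduced to the published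
theorem (VL) at `p = 3`. -/
theorem lemmaPrimeHom_three_of_vasersteinLiehl
    (hVL : ∀ N : ℕ, ¬ 3 ∣ N → VasersteinLiehl (hp := ⟨Nat.prime_three⟩) 3 N) :
    ∀ N : ℕ, ¬ 3 ∣ N → LemmaPrimeHom N 3 := by
  intro N h3
  haveI : Fact (Nat.Prime 3) := ⟨Nat.prime_three⟩
  haveI : NeZero N := ⟨by rintro rfl; exact h3 (dvd_zero 3)⟩
  have hcop : Nat.Coprime 3 N := (Nat.Prime.coprime_iff_not_dvd Nat.prime_three).mpr h3
  exact lemmaPrimeHom_of_vasersteinLiehl hcop (hVL N h3)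

end Summit.BirchSwinnertonDyer.BirchSwinnertonDyer.Cruxes.KobayashiMainConjectureSmallImage.EGLemmaPrime

/-! ## COMPOSITION (g9): THEOREM A at p = 3 — the v6 stub `stub_muOneSign_ns_three` from the single cited input (VL) -/

namespace Summit.BirchSwinnertonDyer.BirchSwinnertonDyer.Cruxes.KobayashiMainConjectureSmallImage.EGLine

open CongruenceSubgroup Literature.NumberTheory.EllipticCurves
  Literature.NumberTheory.EllipticCurves.ModularForms
  Literature.NumberTheory.EllipticCurves.Kobayashi2003
  Literature.NumberTheory.EllipticCurves.GreenbergVatsal2000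
  Literature.NumberTheory.EllipticCurves.Rank1Residual

/-- The two verbatim copies of LEMMA′ agree. -/
theorem lemmaPrimeHom_iff (N p : ℕ) :
    EGLemmaPrime.LemmaPrimeHom N p ↔ LemmaPrimeHom N p := Iff.rfl

/-- **THEOREM A at `p = 3`, kernel form.** From the published Vaserstein–Liehl relative elementary generation for
`SL₂(ℤ[1/3])` at every level `N` prime to `3` (hypothesis `hVL`, cite: Vaserstein 1972 Mat. Sb. 89; Liehl 1981
J. reine angew. Math. 323), the `p = 3` supersingular μ-rider of `Lines/birth_acns.lean` v6 EXACTLY AS TYPED: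
for every elliptic curve in class X7 at 3 (good supersingular, `a₃ = 0`, non-CM, non-surjective mod 3) and its
newform `f`, some plus modular symbol `[u/3^{n+1}]⁺_f` (Ω⁺_f-normalised) is a 3-adic unit — i.e.
`min(μ(L₃⁺(f)), μ(L₃⁻(f))) = 0` (cf. `muOneSign_ns_three_of_lemmaPrimeHom`). Everything else used is a tree theorem
or kernel-checked in this file. -/
theorem stub_muOneSign_ns_three_of_vasersteinLiehl
    (hVL : ∀ N : ℕ, ¬ 3 ∣ N → EGLemmaPrime.VasersteinLiehl (hp := ⟨Nat.prime_three⟩) 3 N) :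
    ∀ (W : WeierstrassCurve ℚ) [W.IsElliptic] [W.IsGloballyMinimal],
    ClassX7 W 3 → ¬ W.HasCM → W.frobeniusTrace 3 = 0 → ¬ Surj W 3 →
    ∀ [NeZero (W.conductorNorm ℤ)] (f : CuspForm (Gamma0 (W.conductorNorm ℤ)) 2),
    IsNewformOf W f → ∃ (n : ℕ) (u : (ZMod (3 ^ (n + 1)))ˣ),
      ‖((ratPlusSymbol f (((u : ZMod (3 ^ (n + 1))).val : ℚ) / (3 : ℚ) ^ (n + 1)) : ℚ) : ℚ_[3])‖ = 1 :=
  stub_muOneSign_ns_three_of_lemmaPrimeHom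
    (fun N hN => (lemmaPrimeHom_iff N 3).mp (EGLemmaPrime.lemmaPrimeHom_three_of_vasersteinLiehl hVL N hN))

/-- Same, in the `HasUnitContent` form: one of Pollack's signed 3-adic L-functions of `f` has `μ = 0`. -/
theorem muOneSign_ns_three_of_vasersteinLiehl
    (hVL : ∀ N : ℕ, ¬ 3 ∣ N → EGLemmaPrime.VasersteinLiehl (hp := ⟨Nat.prime_three⟩) 3 N)
    {N : ℕ} [NeZero N] {f : CuspForm (Gamma0 N) 2} {W : WeierstrassCurve ℚ} [W.IsElliptic] [W.IsGloballyMinimal]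
    (hf : IsNewformOf W f) (hgood : W.HasGoodReductionAtPrime 3) (hap : W.frobeniusTrace 3 = 0) :
    ∃ (ε : ℤˣ) (L : IwasawaAlgebra 3), IsSignedPAdicLFunction f 3 ε L ∧ HasUnitContent L :=
  exists_sign_hasUnitContent_three_of_lemmaPrimeHom hf hgood hap
    ((lemmaPrimeHom_iff N 3).mp (EGLemmaPrime.lemmaPrimeHom_three_of_vasersteinLiehl hVL N
      (not_dvd_level_of_isNewformOf hf hgood)))

end Summit.BirchSwinnertonDyer.BirchSwinnertonDyer.Cruxes.KobayashiMainConjectureSmallImage.EGLine
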